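import Mathlib
import HarnessLib
import Literature.NumberTheory.LFunctions.ZetaSubconvexity
import Literature.NumberTheory.LFunctions.LogSumBlocks
import Literature.NumberTheory.LFunctions.HSumStructure
import Literature.NumberTheory.LFunctions.SecondSpacingOfBlocks
import Literature.NumberTheory.LFunctions.CubicSumAiry
import Literature.NumberTheory.DiophantineApproximation.RationalsNearSeparatedPoints

/-!
# Block estimates for Bourgain's zeta sum `∑ e(T log(m/M))`: data, counts, per-block bounds, envelopes (PROVED)

Topic `Literature/NumberTheory/LFunctions`. Ingredients for the proof of (3.12)–(3.13) of J. Bourgain,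
*Decoupling, exponential sums and the Riemann zeta function*, J. AMS 30 (2017), §4, for `F = log`
from Corollary 3, via the Huxley–Watt reduction rebuilt in `LogSumBlocks`, `CubicSumStructure`,
`CubicSumAiry`, `HSumStructure(5)`, `SixthMomentFiveCoordinates`, `SecondSpacingOfBlocks`:

* **Block data** (`xpt`, `rOf`, `abarOf`, …): the positive point `x = T/(2m²)`, the numerator
  `r = -a ≥ 1`, an inverse `ā`, coprimality, `|x - r/q| ≤ η`, and the identity
  `kappa (T/(3m³)) q = kap T (q(2x)^{1/2})` linking `HSumStructure.kappa` to `SecondSpacingOfBlocks.kap`.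
* **Separation and multiplicity** (`abs_xcoef_blockStart_sub_ge`, `card_filter_rational_le`): the
  points `x_k` of distinct blocks are `Tℓ/(2M³)`-separated, so at most `2η/δ + 1` blocks share a
  rational; **counts** (`card_filter_le_far`, `card_filter_le_near`): the number of blocks with
  denominator `≥ Q` resp. in `[Q₁, Q₂)` via `RationalsNearSeparatedPoints` (Bourgain:
  "∑|𝓘(Q,ℓ)| ≪ MR²/(NQ²) + R²/Q").
* **Per-block bounds** (`norm_cubicSum_le_major`, `norm_cubicSum_le_minor`, `norm_mainTerm_le_triv`):
  major arcs (`μqN'² < 1`) trivially after `cubicSum_structure`; minor arcs: `‖S‖ ≤ err + ‖MT‖`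
  (`cubicSum_airy`) and the trivial bound `‖MT‖ ≤ 15 (μq)^{1/2} N'^{3/2}`.
* **Envelopes** with explicit constants for the factors of the family estimate on the sieve arcs
  `R⁴ ≤ Q³N` (`prefactor_le`, `mx_le`, `box5_le`, `near_env`, `far_env`, `delta2_le`, `gk_terms_le`),
  and the **log-linear verification** (`LogRel`, `bracket_*`) that each resulting monomial is
  `≪ M¹²N⁻⁴R⁻²` — the exponent bookkeeping behind (3.12).

Everything is PROVED; no named fact is introduced.

## References

* J. Bourgain, *Decoupling, exponential sums and the Riemann zeta function*, J. Amer. Math. Soc. 30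
  (2017), 205–224 — §4, (3.4)–(3.12). [BourgainJAMS2017]
* S. W. Graham, G. Kolesnik, *Van der Corput's Method of Exponential Sums*, LMS Lecture Note Series
  126, Cambridge Univ. Press 1991 — §7.7, Lemma 7.18. [GrahamKolesnik1991]
* M. N. Huxley, N. Watt, *Exponential sums and the Riemann zeta function*, Proc. London Math. Soc.
  (3) 57 (1988), 1–24 — §4. [HuxleyWatt1988]
-/

noncomputable section

open Real Complex Finset MeasureTheory
open Literature.Analysis.Fourier (fresnelC norm_fresnelC_le)
open Literature.Analysis.Fourier.AiryHardy (trap trap_nonneg trap_le_one)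
open Literature.NumberTheory.EllipticCurves.ModularForms (quadGaussSum)
open Literature.NumberTheory.LFunctions.LogSumBlocks (blockStart blockCount qOf aOf bOf muOf sOf lamOf xcoef eta
  eta_pos muOf_pos qOf_pos qOf_le abs_xcoef_sub_le isUnit_aOf abs_q_mul_lamOf_le abs_sOf_le farFromRationals_qOf)
open Literature.NumberTheory.LFunctions.SecondSpacingLog (kap kap_pos cube_mul_kap_sq delta2)
open Literature.NumberTheory.LFunctions.HSum (kappa kappa_pos fr xvec ampl ampl_le airyMain_eq ampl_pos)
open Literature.NumberTheory.LFunctions.CubicSum (cubicSum airyTrap airyMain window stationaryWindow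
  mem_stationaryWindow_iff mem_window_bounds cubicSum_structure cubicSum_airy norm_quadGaussSum_le_sqrt)
open Literature.NumberTheory.DiophantineApproximation (FarFromRationals card_le_of_separated
  card_filter_farFromRationals_le card_filter_exists_near_rational_le)

namespace Literature.NumberTheory.LFunctions
namespace ZetaSum


/-! ### Block data as functions of the Taylor point `m` -/

/-- The Taylor point of block `k`: `m_k = ⌈M/2⌉ - 1 + kℓ - L`. [folklore] -/
def mOf (M : ℝ) (ℓ L k : ℕ) : ℝ := (blockStart M ℓ L k : ℝ)

/-- The positive point `x = |f''(m)|/2 = T/(2m²)` (`xcoef = -x`). [folklore] -/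
def xpt (T m : ℝ) : ℝ := T / (2 * m ^ 2)

/-- `xpt = -xcoef`. [folklore] -/
theorem xpt_eq (T m : ℝ) : xpt T m = -xcoef T m := by unfold xpt xcoef; ring

/-- The numerator `r = -a > 0` of the block's rational. [folklore] -/
def rOf (T m : ℝ) (R : ℕ) : ℤ := -aOf T m R

/-- An inverse `ā` of `a` modulo `q` (as an integer in `[0, q)`). [folklore] -/
def abarOf (T m : ℝ) (R : ℕ) : ℤ := ((((aOf T m R : ℤ) : ZMod (qOf T m R)))⁻¹).val

/-- `a ā = 1` in `ℤ/q`. [folklore] -/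
theorem a_mul_abar {T m : ℝ} {R : ℕ} (hR : 1 ≤ R) :
    ((aOf T m R : ℤ) : ZMod (qOf T m R)) * ((abarOf T m R : ℤ) : ZMod (qOf T m R)) = 1 := by
  unfold abarOf
  rw [Int.cast_natCast, ZMod.natCast_zmod_val]
  exact ZMod.mul_inv_of_unit _ (isUnit_aOf hR)

/-- `-r ā ≡ 1 (mod q)` (the form used by `SecondSpacingOfBlocks`). [folklore] -/
theorem neg_r_mul_abar {T m : ℝ} {R : ℕ} (hR : 1 ≤ R) :
    -(rOf T m R) * abarOf T m R ≡ 1 [ZMOD (qOf T m R : ℕ)] := by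
  rw [rOf, neg_neg, ← ZMod.intCast_eq_intCast_iff]
  push_cast
  exact a_mul_abar hR

/-- `r` and `q` are coprime. [folklore] -/
theorem isCoprime_r_q {T m : ℝ} {R : ℕ} (hR : 1 ≤ R) : IsCoprime (rOf T m R) (qOf T m R : ℤ) := by
  have h := a_mul_abar (T := T) (m := m) hR
  -- `a ā = 1 + q t` for some `t`
  have h' : ((aOf T m R * abarOf T m R : ℤ) : ZMod (qOf T m R)) = ((1 : ℤ) : ZMod (qOf T m R)) := by
    push_cast; exact h
  rw [ZMod.intCast_eq_intCast_iff] at h'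
  have hdvd : (qOf T m R : ℤ) ∣ aOf T m R * abarOf T m R - 1 := (Int.ModEq.dvd h').neg_right |> fun hd => by
    simpa [neg_sub] using hd
  obtain ⟨t, ht⟩ := hdvd
  refine ⟨-abarOf T m R, -t, ?_⟩
  rw [rOf]
  linarith [ht]

/-- `|x - r/q| ≤ η` in the positive normalisation. [folklore] -/
theorem abs_xpt_sub_le {T m : ℝ} {R : ℕ} (hR : 1 ≤ R) :
    |xpt T m - rOf T m R / qOf T m R| ≤ LogSumBlocks.eta R := by
  rw [xpt_eq, rOf, show -xcoef T m - ((-aOf T m R : ℤ) : ℝ) / (qOf T m R : ℕ) =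
    -(xcoef T m - aOf T m R / qOf T m R) by push_cast; ring, abs_neg]
  exact abs_xcoef_sub_le hR

/-- `a < 0`, i.e. `r ≥ 1`, as soon as `|x| > η` (here `x ≤ -1/2 < -η`). [folklore] -/
theorem one_le_r {T m : ℝ} {R : ℕ} (hR : 1 ≤ R) (hx : LogSumBlocks.eta R < xpt T m) : 1 ≤ rOf T m R := by
  have h := abs_le.1 (abs_xpt_sub_le (T := T) (m := m) hR)
  have hq : (0 : ℝ) < (qOf T m R : ℕ) := by exact_mod_cast qOf_pos
  have hpos : (0 : ℝ) < rOf T m R / qOf T m R := by linarith [h.2]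
  have : (0 : ℝ) < rOf T m R := by
    by_contra hle
    rw [not_lt] at hle
    have := div_nonpos_of_nonpos_of_nonneg hle hq.le
    linarith
  exact_mod_cast (show (0 : ℤ) < rOf T m R by exact_mod_cast this)

/-! ### The identity `κ = kap T G`, `G = q (2x)^{1/2} = q T^{1/2}/m` -/

/-- For `μ = T/(3m³)` and `x = T/(2m²)`: `kappa μ q = kap T (q (2x)^{1/2})` (`m, T, q > 0`). [folklore] -/
theorem kappa_muOf_eq {T m : ℝ} (hT : 0 < T) (hm : 0 < m) {q : ℝ} (hq : 0 < q) :
    kappa (muOf T m) q = kap T (q * Real.sqrt (2 * xpt T m)) := by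
  unfold kappa muOf kap xpt
  have h2x : 2 * (T / (2 * m ^ 2)) = T / m ^ 2 := by field_simp
  rw [h2x]
  have hsT : 0 < Real.sqrt T := Real.sqrt_pos.2 hT
  have hsm : 0 < Real.sqrt m := Real.sqrt_pos.2 hm
  have hsq : 0 < Real.sqrt q := Real.sqrt_pos.2 hq
  have hs4 : 0 < Real.sqrt (Real.sqrt T) := Real.sqrt_pos.2 hsT
  -- express all square roots through `√T, √m, √q, T^{1/4}`
  have e1 : Real.sqrt (T / m ^ 2) = Real.sqrt T / m := by
    rw [Real.sqrt_div hT.le, Real.sqrt_sq hm.le]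
  have e2 : Real.sqrt (3 * (T / (3 * m ^ 3)) * q) = Real.sqrt T * Real.sqrt q / (m * Real.sqrt m) := by
    have : 3 * (T / (3 * m ^ 3)) * q = T * q / (m ^ 2 * m) := by field_simp
    rw [this, Real.sqrt_div (by positivity), Real.sqrt_mul hT.le, Real.sqrt_mul (by positivity),
      Real.sqrt_sq hm.le]
  have e3 : Real.sqrt (q * (Real.sqrt T / m)) = Real.sqrt q * Real.sqrt (Real.sqrt T) / Real.sqrt m := by
    rw [Real.sqrt_mul hq.le, Real.sqrt_div (Real.sqrt_nonneg _)]
    ring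
  rw [e1, e2, e3]
  have hTT : Real.sqrt (Real.sqrt T) * Real.sqrt (Real.sqrt T) = Real.sqrt T := Real.mul_self_sqrt hsT.le
  have hmm : Real.sqrt m * Real.sqrt m = m := Real.mul_self_sqrt hm.le
  have hqq : Real.sqrt q * Real.sqrt q = q := Real.mul_self_sqrt hq.le
  have hTT' : Real.sqrt T * Real.sqrt T = T := Real.mul_self_sqrt hT.le
  field_simp



/-! ### Coordinates of `xvec` in the form used by `SecondSpacingOfBlocks` -/

/-- `x₂ = -ā/(4q) - round(-ā/(4q))`. [folklore] -/
theorem xvec_one (q : ℕ) (abar b : ℤ) (μ s lam : ℝ) :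
    xvec q abar b μ s lam 1 = -(abar : ℝ) / (4 * q) - round (-(abar : ℝ) / (4 * q)) := rfl

/-- `x₃ = -κ`. [folklore] -/
theorem xvec_two (q : ℕ) (abar b : ℤ) (μ s lam : ℝ) : xvec q abar b μ s lam 2 = -kappa μ q := rfl

/-! ### The Taylor points are an arithmetic progression; the points `x_k` are separated -/

/-- `m_k = (⌈M/2⌉ - 1 - L) + kℓ` when `L + 1 ≤ ⌈M/2⌉`. [folklore] -/
theorem blockStart_eq {M : ℝ} {ℓ L : ℕ} (hL : L + 1 ≤ ⌈M / 2⌉₊) (k : ℕ) :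
    blockStart M ℓ L k = (⌈M / 2⌉₊ - 1 - L) + k * ℓ := by
  unfold blockStart; omega

/-- `m_k ≥ ⌈M/2⌉ - 1 - L ≥ 1`... as a real: `(⌈M/2⌉ - 1 - L : ℕ) + kℓ`. [folklore] -/
theorem blockStart_cast {M : ℝ} {ℓ L : ℕ} (hL : L + 1 ≤ ⌈M / 2⌉₊) (k : ℕ) :
    (blockStart M ℓ L k : ℝ) = ((⌈M / 2⌉₊ - 1 - L : ℕ) : ℝ) + k * ℓ := by
  rw [blockStart_eq hL]; push_cast; ring

/-- Gaps of `x(m) = -T/(2m²)`: for `1 ≤ m`, `m + ℓ ≤ m' ≤ Mx`, `x(m') - x(m) ≥ Tℓ/(2Mx³)`. [folklore] -/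
theorem xcoef_sub_ge {T m m' ℓ Mx : ℝ} (hT : 0 ≤ T) (hm : 1 ≤ m) (hℓ : 0 ≤ ℓ) (hmm' : m + ℓ ≤ m') (hM : m' ≤ Mx) :
    T * ℓ / (2 * Mx ^ 3) ≤ xcoef T m' - xcoef T m := by
  unfold xcoef
  have hm0 : 0 < m := by linarith
  have hm'0 : 0 < m' := by linarith
  have hMx : 0 < Mx := by linarith
  have e : -(T / (2 * m' ^ 2)) - -(T / (2 * m ^ 2)) = T * ((m' - m) * (m' + m)) / (2 * (m ^ 2 * m' ^ 2)) := by
    field_simp; ring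
  rw [e, div_le_div_iff₀ (by positivity) (by positivity)]
  -- `T ℓ · 2 m² m'² ≤ T (m'-m)(m'+m) · 2 Mx³`; use `ℓ ≤ m' - m`, `m² m'² ≤ ... `: `m'+m ≥ m'`, so RHS ≥ T ℓ m' 2Mx³ ≥ ...
  have h1 : ℓ * (m ^ 2 * m' ^ 2) ≤ (m' - m) * (m' + m) * Mx ^ 3 := by
    have hℓ' : ℓ ≤ m' - m := by linarith
    have h2 : m ^ 2 * m' ^ 2 ≤ (m' + m) * Mx ^ 3 := by
      have h3 : m ^ 2 * m' ≤ Mx ^ 3 := by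
        have hmM : m ≤ Mx := by linarith
        calc m ^ 2 * m' ≤ Mx ^ 2 * Mx := by gcongr
          _ = Mx ^ 3 := by ring
      calc m ^ 2 * m' ^ 2 = (m ^ 2 * m') * m' := by ring
        _ ≤ Mx ^ 3 * m' := by gcongr
        _ ≤ (m' + m) * Mx ^ 3 := by nlinarith [hm0, pow_pos hMx 3]
    calc ℓ * (m ^ 2 * m' ^ 2) ≤ (m' - m) * (m ^ 2 * m' ^ 2) := by gcongr
      _ ≤ (m' - m) * ((m' + m) * Mx ^ 3) := by gcongr; linarith
      _ = (m' - m) * (m' + m) * Mx ^ 3 := by ring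
  nlinarith [h1, hT]

/-- **The points `x_k = -T/(2m_k²)` of distinct blocks are `Tℓ/(2Mx³)`-separated.** [folklore] -/
theorem abs_xcoef_blockStart_sub_ge {T M Mx : ℝ} {ℓ L : ℕ} (hT : 0 ≤ T) (hL : L + 1 ≤ ⌈M / 2⌉₊)
    (hm1 : 1 ≤ ((⌈M / 2⌉₊ - 1 - L : ℕ) : ℝ)) {k k' : ℕ} (hkk' : k ≠ k')
    (hk : (blockStart M ℓ L k : ℝ) ≤ Mx) (hk' : (blockStart M ℓ L k' : ℝ) ≤ Mx) :
    T * ℓ / (2 * Mx ^ 3) ≤ |xcoef T (blockStart M ℓ L k) - xcoef T (blockStart M ℓ L k')| := by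
  wlog h : k' < k generalizing k k'
  · rw [abs_sub_comm]
    exact this hkk'.symm hk' hk (by omega)
  have hm : (1 : ℝ) ≤ (blockStart M ℓ L k' : ℝ) := by
    rw [blockStart_cast hL]
    have : (0:ℝ) ≤ (k' : ℝ) * ℓ := mul_nonneg (Nat.cast_nonneg _) (Nat.cast_nonneg _)
    linarith
  have hmm' : (blockStart M ℓ L k' : ℝ) + ℓ ≤ (blockStart M ℓ L k : ℝ) := by
    rw [blockStart_cast hL, blockStart_cast hL]
    have : (k' : ℝ) + 1 ≤ k := by exact_mod_cast h
    nlinarith [(Nat.cast_nonneg ℓ : (0:ℝ) ≤ ℓ), this]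
  have key := xcoef_sub_ge hT hm (Nat.cast_nonneg ℓ) hmm' hk
  have hδ0 : 0 ≤ T * ℓ / (2 * Mx ^ 3) := by
    have : 0 < Mx := by linarith
    positivity
  rw [abs_of_nonneg (hδ0.trans key)]
  exact key

/-- **Multiplicity of a rational:** among the blocks `k ∈ 𝓕` (Taylor points `≤ Mx`), at most
`2η(2Mx³)/(Tℓ) + 1` have a given value of `(a_k, q_k)` — all their points `x_k` lie within `η` of the
same `a/q` and are `Tℓ/(2Mx³)`-separated. [folklore] -/
theorem card_filter_rational_le {T M Mx : ℝ} {R ℓ L : ℕ} (hT : 0 < T) (hℓ : 1 ≤ ℓ) (hR : 1 ≤ R)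
    (hL : L + 1 ≤ ⌈M / 2⌉₊) (hm1 : 1 ≤ ((⌈M / 2⌉₊ - 1 - L : ℕ) : ℝ)) (hMx : 0 < Mx) (𝓕 : Finset ℕ)
    (h𝓕 : ∀ k ∈ 𝓕, (blockStart M ℓ L k : ℝ) ≤ Mx) (pt : ℤ × ℤ) :
    ((𝓕.filter fun k => ((-(aOf T (blockStart M ℓ L k) R), (qOf T (blockStart M ℓ L k) R : ℤ)) : ℤ × ℤ) = pt).card
        : ℝ) ≤ 2 * LogSumBlocks.eta R / (T * ℓ / (2 * Mx ^ 3)) + 1 := by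
  classical
  set F := 𝓕.filter fun k => ((-(aOf T (blockStart M ℓ L k) R), (qOf T (blockStart M ℓ L k) R : ℤ)) : ℤ × ℤ) = pt
    with hF
  -- the points
  set P : Finset ℝ := F.image fun k => xcoef T (blockStart M ℓ L k) with hP
  have hδ : 0 < T * ℓ / (2 * Mx ^ 3) := by
    have : (1 : ℝ) ≤ ℓ := by exact_mod_cast hℓ
    positivity
  have hinj : Set.InjOn (fun k => xcoef T (blockStart M ℓ L k)) F := by
    intro k hk k' hk' hkk'
    by_contra hne
    have hsep := abs_xcoef_blockStart_sub_ge (ℓ := ℓ) hT.le hL hm1 hne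
      (h𝓕 k (Finset.mem_filter.1 hk).1) (h𝓕 k' (Finset.mem_filter.1 hk').1)
    have hkk'' : xcoef T (blockStart M ℓ L k) = xcoef T (blockStart M ℓ L k') := hkk'
    rw [hkk'', sub_self, abs_zero] at hsep
    linarith
  have hcardP : P.card = F.card := Finset.card_image_of_injOn hinj
  -- all points within `η` of `-pt.1/pt.2`
  rcases F.eq_empty_or_nonempty with hFe | ⟨k₀, hk₀⟩
  · rw [hFe]; simp; have := eta_pos hR; positivity
  have hk₀' := Finset.mem_filter.1 hk₀
  set c : ℝ := (aOf T (blockStart M ℓ L k₀) R : ℝ) / (qOf T (blockStart M ℓ L k₀) R : ℕ) with hc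
  have hclose : ∀ x ∈ P, x ∈ Set.Icc (c - LogSumBlocks.eta R) (c - LogSumBlocks.eta R + 2 * LogSumBlocks.eta R) := by
    intro x hx
    rw [hP, Finset.mem_image] at hx
    obtain ⟨k, hk, rfl⟩ := hx
    have hk' := Finset.mem_filter.1 hk
    -- same rational as `k₀`
    have hsame : ((-(aOf T (blockStart M ℓ L k) R), (qOf T (blockStart M ℓ L k) R : ℤ)) : ℤ × ℤ) =
        ((-(aOf T (blockStart M ℓ L k₀) R), (qOf T (blockStart M ℓ L k₀) R : ℤ)) : ℤ × ℤ) := by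
      rw [hk'.2, hk₀'.2]
    have ha : aOf T (blockStart M ℓ L k) R = aOf T (blockStart M ℓ L k₀) R := by
      have := congrArg Prod.fst hsame; simpa using this
    have hq : qOf T (blockStart M ℓ L k) R = qOf T (blockStart M ℓ L k₀) R := by
      have := congrArg Prod.snd hsame; simp only at this; exact_mod_cast this
    have h := abs_le.1 (abs_xcoef_sub_le (T := T) (m := (blockStart M ℓ L k : ℝ)) hR)
    rw [ha, hq, ← hc] at h
    constructor <;> linarith [h.1, h.2]
  have hsepP : ∀ x ∈ P, ∀ y ∈ P, x ≠ y → T * ℓ / (2 * Mx ^ 3) ≤ |x - y| := by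
    intro x hx y hy hxy
    rw [hP, Finset.mem_image] at hx hy
    obtain ⟨k, hk, rfl⟩ := hx
    obtain ⟨k', hk', rfl⟩ := hy
    have hne : k ≠ k' := fun h => hxy (by rw [h])
    exact abs_xcoef_blockStart_sub_ge hT.le hL hm1 hne (h𝓕 k (Finset.mem_filter.1 hk).1)
      (h𝓕 k' (Finset.mem_filter.1 hk').1)
  have := card_le_of_separated hδ (mul_nonneg zero_le_two (eta_pos hR).le) hsepP hclose
  rw [hcardP] at this
  exact this



/-! ### Counting blocks by the size of their denominator -/

section
variable {T M Mx u Λ : ℝ} {R ℓ L : ℕ} (𝓚 : Finset ℕ)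

/-- Transport of a count along the injection `k ↦ x_k`. [folklore] -/
theorem card_filter_le_card_image_filter {P : ℕ → Prop} {Q : ℝ → Prop} [DecidablePred P] [DecidablePred Q]
    (x : ℕ → ℝ) (hinj : Set.InjOn x 𝓚) (hPQ : ∀ k ∈ 𝓚, P k → Q (x k)) :
    (𝓚.filter P).card ≤ ((𝓚.image x).filter Q).card := by
  classical
  calc (𝓚.filter P).card = ((𝓚.filter P).image x).card :=
        (Finset.card_image_of_injOn (hinj.mono (by intro k hk; exact (Finset.mem_filter.1 hk).1))).symm
    _ ≤ ((𝓚.image x).filter Q).card := by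
        refine Finset.card_le_card fun y hy => ?_
        rw [Finset.mem_image] at hy
        obtain ⟨k, hk, rfl⟩ := hy
        rw [Finset.mem_filter] at hk ⊢
        exact ⟨Finset.mem_image_of_mem _ hk.1, hPQ k hk.1 hk.2⟩

/-- **Blocks with a large denominator** (`q_k ≥ Q ≥ 2`) are far from all rationals of denominator
`< Q`; their number is at most `(1/(ηQ))((2Λ+4)/(Qδ) + 2) + Λ/(ηQ)²`, `δ = Tℓ/(2Mx³)`, when the
points `x_k` lie in an interval of length `Λ`. [cite: BourgainJAMS2017, §4, display after (3.4) ("∑|𝓘(Q,ℓ)| ≪ MR²/(NQ²) + R²/Q")] -/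
theorem card_filter_le_far (hT : 0 < T) (hℓ : 1 ≤ ℓ) (hR : 1 ≤ R) (hL : L + 1 ≤ ⌈M / 2⌉₊)
    (hm1 : 1 ≤ ((⌈M / 2⌉₊ - 1 - L : ℕ) : ℝ)) (hMx : 0 < Mx) (hΛ : 0 ≤ Λ)
    (h𝓚 : ∀ k ∈ 𝓚, (blockStart M ℓ L k : ℝ) ≤ Mx)
    (hx : ∀ k ∈ 𝓚, xcoef T (blockStart M ℓ L k) ∈ Set.Icc u (u + Λ)) {Q : ℕ} (hQ : 2 ≤ Q) :
    ((𝓚.filter fun k => Q ≤ qOf T (blockStart M ℓ L k) R).card : ℝ) ≤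
      1 / (LogSumBlocks.eta R * Q) * ((2 * Λ + 4) / (Q * (T * ℓ / (2 * Mx ^ 3))) + 2) + Λ / (LogSumBlocks.eta R * Q) ^ 2 := by
  classical
  set x : ℕ → ℝ := fun k => xcoef T (blockStart M ℓ L k) with hxdef
  have hℓR : (1:ℝ) ≤ ℓ := by exact_mod_cast hℓ
  have hδ : 0 < T * ℓ / (2 * Mx ^ 3) := by positivity
  have hinj : Set.InjOn x 𝓚 := by
    intro k hk k' hk' hkk'
    by_contra hne
    have hsep := abs_xcoef_blockStart_sub_ge hT.le hL hm1 hne (h𝓚 k hk) (h𝓚 k' hk')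
    have : x k = x k' := hkk'
    simp only [hxdef] at this
    rw [this, sub_self, abs_zero] at hsep
    linarith
  have h1 := card_filter_le_card_image_filter 𝓚 x hinj (P := fun k => Q ≤ qOf T (blockStart M ℓ L k) R)
    (Q := FarFromRationals (LogSumBlocks.eta R) Q) (fun k _ hk => ?_)
  swap
  · -- far from rationals of denominator `< Q ≤ q_k`
    intro q' hq' hq'Q a
    exact farFromRationals_qOf hR q' hq' (lt_of_lt_of_le hq'Q hk) a
  have hP : ∀ y ∈ 𝓚.image x, y ∈ Set.Icc u (u + Λ) := by
    intro y hy; rw [Finset.mem_image] at hy; obtain ⟨k, hk, rfl⟩ := hy; exact hx k hk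
  have hsep : ∀ y ∈ 𝓚.image x, ∀ y' ∈ 𝓚.image x, y ≠ y' → T * ℓ / (2 * Mx ^ 3) ≤ |y - y'| := by
    intro y hy y' hy' hyy'
    rw [Finset.mem_image] at hy hy'
    obtain ⟨k, hk, rfl⟩ := hy
    obtain ⟨k', hk', rfl⟩ := hy'
    have hne : k ≠ k' := fun h => hyy' (by rw [h])
    exact abs_xcoef_blockStart_sub_ge hT.le hL hm1 hne (h𝓚 k hk) (h𝓚 k' hk')
  have h2 := card_filter_farFromRationals_le (𝓚.image x) hδ (eta_pos hR) hΛ hsep hP hQ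
  exact le_trans (by exact_mod_cast h1) h2

/-- **Blocks with a denominator in `[Q₁, Q₂)`** are `η`-close to a rational of such a denominator; their
number is at most `(Q₂ - Q₁)(Q₂(Λ + 2η) + 1)(2η/δ + 1)`. [folklore] -/
theorem card_filter_le_near (hT : 0 < T) (hℓ : 1 ≤ ℓ) (hR : 1 ≤ R) (hL : L + 1 ≤ ⌈M / 2⌉₊)
    (hm1 : 1 ≤ ((⌈M / 2⌉₊ - 1 - L : ℕ) : ℝ)) (hMx : 0 < Mx) (hΛ : 0 ≤ Λ)
    (h𝓚 : ∀ k ∈ 𝓚, (blockStart M ℓ L k : ℝ) ≤ Mx)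
    (hx : ∀ k ∈ 𝓚, xcoef T (blockStart M ℓ L k) ∈ Set.Icc u (u + Λ)) {Q₁ Q₂ : ℕ} (hQ₁ : 0 < Q₁) (hQ : Q₁ ≤ Q₂) :
    ((𝓚.filter fun k => Q₁ ≤ qOf T (blockStart M ℓ L k) R ∧ qOf T (blockStart M ℓ L k) R < Q₂).card : ℝ) ≤
      ((Q₂ : ℝ) - Q₁) * (Q₂ * (Λ + 2 * LogSumBlocks.eta R) + 1) * (2 * LogSumBlocks.eta R / (T * ℓ / (2 * Mx ^ 3)) + 1) := by
  classical
  set x : ℕ → ℝ := fun k => xcoef T (blockStart M ℓ L k) with hxdef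
  have hℓR : (1:ℝ) ≤ ℓ := by exact_mod_cast hℓ
  have hδ : 0 < T * ℓ / (2 * Mx ^ 3) := by positivity
  have hinj : Set.InjOn x 𝓚 := by
    intro k hk k' hk' hkk'
    by_contra hne
    have hsep := abs_xcoef_blockStart_sub_ge hT.le hL hm1 hne (h𝓚 k hk) (h𝓚 k' hk')
    have : x k = x k' := hkk'
    simp only [hxdef] at this
    rw [this, sub_self, abs_zero] at hsep
    linarith
  have h1 := card_filter_le_card_image_filter 𝓚 x hinj
    (P := fun k => Q₁ ≤ qOf T (blockStart M ℓ L k) R ∧ qOf T (blockStart M ℓ L k) R < Q₂)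
    (Q := fun y : ℝ => ∃ q : ℕ, Q₁ ≤ q ∧ q < Q₂ ∧ ∃ a : ℤ, |y - a / q| ≤ LogSumBlocks.eta R) (fun k _ hk => ?_)
  swap
  · exact ⟨qOf T (blockStart M ℓ L k) R, hk.1, hk.2, aOf T (blockStart M ℓ L k) R, abs_xcoef_sub_le hR⟩
  have hP : ∀ y ∈ 𝓚.image x, y ∈ Set.Icc u (u + Λ) := by
    intro y hy; rw [Finset.mem_image] at hy; obtain ⟨k, hk, rfl⟩ := hy; exact hx k hk
  have hsep : ∀ y ∈ 𝓚.image x, ∀ y' ∈ 𝓚.image x, y ≠ y' → T * ℓ / (2 * Mx ^ 3) ≤ |y - y'| := by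
    intro y hy y' hy' hyy'
    rw [Finset.mem_image] at hy hy'
    obtain ⟨k, hk, rfl⟩ := hy
    obtain ⟨k', hk', rfl⟩ := hy'
    have hne : k ≠ k' := fun h => hyy' (by rw [h])
    exact abs_xcoef_blockStart_sub_ge hT.le hL hm1 hne (h𝓚 k hk) (h𝓚 k' hk')
  have h2 := card_filter_exists_near_rational_le (𝓚.image x) hδ (eta_pos hR).le hΛ hsep hP hQ₁ hQ
  exact le_trans (by exact_mod_cast h1) h2

end



section PerBlock
variable {q : ℕ} [NeZero q]

/-! ### Per-block estimates for the twisted cubic sum -/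

/-- The main term `MT = q⁻¹ ∑_{h∈W'} G(a, b+h; q) e(ω_h s) airyMain(h - qλ)` of `cubicSum_airy`.
[folklore] -/
def mainTerm (q : ℕ) [NeZero q] (a b : ℤ) (μ s lam N N₁ : ℝ) : ℂ :=
  (1 / (q : ℂ)) * ∑ h ∈ stationaryWindow q μ s lam N N₁,
    quadGaussSum q a ((b : ZMod q) + (h : ZMod q)) *
      (Complex.exp (2 * π * I * ((h - q * lam) / q * s : ℝ)) * airyMain μ q (h - q * lam))

/-- `|airyTrap| ≤ P₁ + 1 - P` (the weight is in `[0, 1]`, the phase unimodular). [folklore] -/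
theorem norm_airyTrap_le {μ c P P₁ h : ℝ} (hP : P ≤ P₁ + 1) : ‖airyTrap μ c P P₁ h‖ ≤ P₁ + 1 - P := by
  unfold airyTrap
  have h1 : ‖∫ y in P..(P₁ + 1), (trap P P₁ y : ℂ) * Complex.exp (2 * π * I * (μ * y ^ 3 - h / c * y : ℝ))‖
      ≤ 1 * |P₁ + 1 - P| := by
    refine intervalIntegral.norm_integral_le_of_norm_le_const fun y _ => ?_
    rw [norm_mul, CubicSum.norm_e_real, mul_one, Complex.norm_real, Real.norm_eq_abs, abs_of_nonneg (trap_nonneg _ _ _)]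
    exact trap_le_one _ _ _
  rwa [abs_of_nonneg (by linarith), one_mul] at h1


/-- `#[a, b] ≤ max(b - a + 1, 0)` for integers, as reals. [folklore] -/
theorem card_Icc_int_le (a b : ℤ) : ((Finset.Icc a b).card : ℝ) ≤ max ((b : ℝ) - a + 1) 0 := by
  rw [Int.card_Icc]
  rcases le_or_gt (b + 1 - a) 0 with h | h
  · rw [Int.toNat_of_nonpos h]; simp
  · have h1 : (((b + 1 - a).toNat : ℕ) : ℤ) = b + 1 - a := Int.toNat_of_nonneg h.le
    have h2 : (((b + 1 - a).toNat : ℕ) : ℝ) = (b : ℝ) + 1 - a := by exact_mod_cast h1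
    rw [h2]
    exact le_max_of_le_left (by linarith)

/-- **Major-arc block (`μqN'² < 1`): trivial treatment of the Poisson main part.** Under the hypotheses
of `cubicSum_structure`, `‖S‖ ≤ 2 + 11/(μN'²) + 227√q(1+log q) + 37√(2q)(N₁ + 1 - N)`. [folklore] -/
theorem norm_cubicSum_le_major {a : ℤ} (ha : IsUnit (a : ZMod q)) (b : ℤ) {μ s lam N N₁ : ℝ}
    (hμ : 0 < μ) (hN : 1 ≤ N) (hNN₁ : N + 1 ≤ N₁) (hN' : 1 ≤ N + s) (hN₁' : N₁ + s ≤ 2 * (N + s))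
    (hμN : μ * (N + s) ^ 2 ≤ 1) (hlam : |q * lam| ≤ 1 / 2) :
    ‖cubicSum q a b μ s lam N N₁‖ ≤
      2 + 11 / (μ * (N + s) ^ 2) + 227 * Real.sqrt q * (1 + Real.log q) +
        37 * Real.sqrt (2 * q) * (N₁ + 1 - N) := by
  classical
  have hq1 : 1 ≤ q := Nat.pos_of_ne_zero (NeZero.ne q)
  have hq0 : (0 : ℝ) < q := by exact_mod_cast hq1
  have hA := cubicSum_structure ha b hμ hN hNN₁ hN' hN₁' hμN hlam
  set MTt := (1 / (q : ℂ)) * ∑ h ∈ window q μ s lam N N₁,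
    quadGaussSum q a ((b : ZMod q) + (h : ZMod q)) *
      (Complex.exp (2 * π * I * ((h - q * lam) / q * s : ℝ)) * airyTrap μ q (N + s) (N₁ + s) (h - q * lam))
    with hMTt
  -- bound the trapezoid main part trivially
  have hterm : ∀ h ∈ window q μ s lam N N₁, ‖quadGaussSum q a ((b : ZMod q) + (h : ZMod q)) *
      (Complex.exp (2 * π * I * ((h - q * lam) / q * s : ℝ)) * airyTrap μ q (N + s) (N₁ + s) (h - q * lam))‖
      ≤ Real.sqrt (2 * q) * (N₁ + 1 - N) := by
    intro h _
    rw [norm_mul, norm_mul, CubicSum.norm_e_real, one_mul]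
    refine mul_le_mul (norm_quadGaussSum_le_sqrt ha _) ?_ (norm_nonneg _) (Real.sqrt_nonneg _)
    have := norm_airyTrap_le (μ := μ) (c := (q : ℝ)) (P := N + s) (P₁ := N₁ + s) (h := (h : ℝ) - q * lam)
      (by linarith)
    linarith
  have hcard : ((window q μ s lam N N₁).card : ℝ) ≤ 36 * q + 1 := by
    have hsub : window q μ s lam N N₁ ⊆ Finset.Icc (0 : ℤ) (36 * q) := by
      intro h hh
      have := mem_window_bounds hμ hNN₁ hN' hN₁' hμN hlam hh
      rw [Finset.mem_Icc]; exact ⟨this.1, by exact_mod_cast this.2⟩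
    calc ((window q μ s lam N N₁).card : ℝ) ≤ ((Finset.Icc (0 : ℤ) (36 * q)).card : ℝ) := by
          exact_mod_cast Finset.card_le_card hsub
      _ ≤ max ((((36 * q : ℕ) : ℤ) : ℝ) - ((0 : ℤ) : ℝ) + 1) 0 := card_Icc_int_le _ _
      _ = 36 * q + 1 := by push_cast; rw [sub_zero, max_eq_left (by positivity)]
  have hMT : ‖MTt‖ ≤ 37 * Real.sqrt (2 * q) * (N₁ + 1 - N) := by
    rw [hMTt, norm_mul, norm_div, norm_one, Complex.norm_natCast]
    have hs := norm_sum_le (window q μ s lam N N₁) (fun h =>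
      quadGaussSum q a ((b : ZMod q) + (h : ZMod q)) *
        (Complex.exp (2 * π * I * ((h - q * lam) / q * s : ℝ)) * airyTrap μ q (N + s) (N₁ + s) (h - q * lam)))
    have hs' := hs.trans (Finset.sum_le_sum hterm)
    rw [Finset.sum_const, nsmul_eq_mul] at hs'
    have hlen : 0 ≤ N₁ + 1 - N := by linarith
    calc 1 / (q : ℝ) * ‖∑ h ∈ window q μ s lam N N₁, quadGaussSum q a ((b : ZMod q) + (h : ZMod q)) *
          (Complex.exp (2 * π * I * ((h - q * lam) / q * s : ℝ)) * airyTrap μ q (N + s) (N₁ + s) (h - q * lam))‖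
        ≤ 1 / (q : ℝ) * ((36 * q + 1) * (Real.sqrt (2 * q) * (N₁ + 1 - N))) := by
          refine mul_le_mul_of_nonneg_left (hs'.trans ?_) (by positivity)
          exact mul_le_mul_of_nonneg_right hcard (by positivity)
      _ ≤ 37 * Real.sqrt (2 * q) * (N₁ + 1 - N) := by
          rw [div_mul_eq_mul_div, one_mul, div_le_iff₀ hq0]
          have hq1R : (1 : ℝ) ≤ q := by exact_mod_cast hq1
          have : 0 ≤ Real.sqrt (2 * q) * (N₁ + 1 - N) := by positivity
          nlinarith
  have htri := norm_sub_norm_le (cubicSum q a b μ s lam N N₁) MTt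
  linarith

/-- **Minor-arc block (`μqN'² ≥ 1`): `‖S‖ ≤ err + ‖MT‖`.** [folklore] -/
theorem norm_cubicSum_le_minor {a : ℤ} (ha : IsUnit (a : ZMod q)) (b : ℤ) {μ s lam N N₁ : ℝ}
    (hμ : 0 < μ) (hN : 1 ≤ N) (hNN₁ : N + 1 ≤ N₁) (hN' : 1 ≤ N + s) (hN₁' : N₁ + s ≤ 2 * (N + s))
    (hμN : μ * (N + s) ^ 2 ≤ 1) (hlam : |q * lam| ≤ 1 / 2) (hH : 1 ≤ μ * q * (N + s) ^ 2) :
    ‖cubicSum q a b μ s lam N N₁‖ ≤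
      (2 + 11 / (μ * (N + s) ^ 2) + 90 * Real.sqrt (N + s) + 2222 * Real.sqrt q * (1 + Real.log q)) +
        ‖mainTerm q a b μ s lam N N₁‖ := by
  have h := cubicSum_airy ha b hμ hN hNN₁ hN' hN₁' hμN hlam hH
  have := norm_sub_norm_le (cubicSum q a b μ s lam N N₁) (mainTerm q a b μ s lam N N₁)
  unfold mainTerm at this ⊢
  linarith

/-- **Trivial bound for the main term:** `‖MT‖ ≤ 15 (μ q)^{1/2} N'^{3/2}` when `μqN'² ≥ 1`
(`#W' ≤ 9μqN'² + 1`, `|G| ≤ (2q)^{1/2}`, `|airyMain| ≤ 6 (12πμN')^{-1/2}`). [folklore] -/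
theorem norm_mainTerm_le_triv {a : ℤ} (ha : IsUnit (a : ZMod q)) (b : ℤ) {μ s lam N N₁ : ℝ}
    (hμ : 0 < μ) (hN' : 1 ≤ N + s) (hNN₁ : N ≤ N₁) (hN₁' : N₁ + s ≤ 2 * (N + s))
    (hH : 1 ≤ μ * q * (N + s) ^ 2) :
    ‖mainTerm q a b μ s lam N N₁‖ ≤ 15 * Real.sqrt (μ * q) * (N + s) * Real.sqrt (N + s) := by
  classical
  have hq1 : 1 ≤ q := Nat.pos_of_ne_zero (NeZero.ne q)
  have hq0 : (0 : ℝ) < q := by exact_mod_cast hq1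
  have hN'0 : 0 < N + s := by linarith
  set W' := stationaryWindow q μ s lam N N₁ with hW'
  -- size of each term
  have hamp : ∀ h ∈ W', ‖airyMain μ q ((h : ℝ) - q * lam)‖ ≤ 6 / Real.sqrt (12 * π * μ * (N + s)) := by
    intro h hh
    rw [hW', mem_stationaryWindow_iff] at hh
    have hh0 : 0 ≤ (h : ℝ) - q * lam := le_trans (by positivity) hh.1
    rw [airyMain_eq hμ hq0 hh0, norm_mul, norm_mul, Complex.norm_real, Real.norm_eq_abs,
      abs_of_pos (ampl_pos hμ hq0 (lt_of_lt_of_le (by positivity) hh.1))]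
    rw [show (2 * π * I * (-(kappa μ q * HSum.pow32 ((h : ℝ) - q * lam)) : ℝ) : ℂ) =
      ((2 * π * (-(kappa μ q * HSum.pow32 ((h : ℝ) - q * lam))) : ℝ) : ℂ) * I by push_cast; ring,
      Complex.norm_exp_ofReal_mul_I, mul_one]
    have := ampl_le hμ hq0 hN'0 hh.1
    calc ‖fresnelC‖ * ampl μ q ((h : ℝ) - q * lam) ≤ 6 * (1 / Real.sqrt (12 * π * μ * (N + s))) :=
          mul_le_mul norm_fresnelC_le this (ampl_pos hμ hq0 (lt_of_lt_of_le (by positivity) hh.1)).le (by norm_num)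
      _ = 6 / Real.sqrt (12 * π * μ * (N + s)) := by ring
  have hterm : ∀ h ∈ W', ‖quadGaussSum q a ((b : ZMod q) + (h : ZMod q)) *
      (Complex.exp (2 * π * I * ((h - q * lam) / q * s : ℝ)) * airyMain μ q (h - q * lam))‖
      ≤ Real.sqrt (2 * q) * (6 / Real.sqrt (12 * π * μ * (N + s))) := by
    intro h hh
    rw [norm_mul, norm_mul, CubicSum.norm_e_real, one_mul]
    exact mul_le_mul (norm_quadGaussSum_le_sqrt ha _) (hamp h hh) (norm_nonneg _) (Real.sqrt_nonneg _)
  -- number of terms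
  have hcard : (W'.card : ℝ) ≤ 9 * (μ * q * (N + s) ^ 2) + 1 := by
    rw [hW', stationaryWindow]
    refine (card_Icc_int_le _ _).trans (max_le ?_ (by positivity))
    have h1 := Int.floor_le ((q : ℝ) * lam + 3 * μ * q * (N₁ + s) ^ 2)
    have h2 := Int.le_ceil ((q : ℝ) * lam + 3 * μ * q * (N + s) ^ 2)
    have hsq : (N₁ + s) ^ 2 ≤ 4 * (N + s) ^ 2 := by
      have : N + s ≤ N₁ + s := by linarith
      nlinarith
    have hμq : 0 ≤ μ * q := by positivity
    nlinarith [mul_le_mul_of_nonneg_left hsq hμq]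
  -- assemble
  unfold mainTerm
  rw [norm_mul, norm_div, norm_one, Complex.norm_natCast, ← hW']
  have hs := (norm_sum_le W' _).trans (Finset.sum_le_sum hterm)
  rw [Finset.sum_const, nsmul_eq_mul] at hs
  have hH0 : 0 ≤ μ * q * (N + s) ^ 2 := by positivity
  calc 1 / (q : ℝ) * ‖∑ h ∈ W', quadGaussSum q a ((b : ZMod q) + (h : ZMod q)) *
        (Complex.exp (2 * π * I * ((h - q * lam) / q * s : ℝ)) * airyMain μ q (h - q * lam))‖
      ≤ 1 / (q : ℝ) * ((9 * (μ * q * (N + s) ^ 2) + 1) * (Real.sqrt (2 * q) * (6 / Real.sqrt (12 * π * μ * (N + s))))) := by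
        refine mul_le_mul_of_nonneg_left (hs.trans ?_) (by positivity)
        exact mul_le_mul_of_nonneg_right hcard (by positivity)
    _ ≤ 1 / (q : ℝ) * ((10 * (μ * q * (N + s) ^ 2)) * (Real.sqrt (2 * q) * (6 / Real.sqrt (12 * π * μ * (N + s))))) := by
        gcongr; linarith
    _ = 60 * Real.sqrt 2 / Real.sqrt (12 * π) * (Real.sqrt (μ * q) * (N + s) * Real.sqrt (N + s)) := by
        -- `q⁻¹ μqN'² √(2q) /√(12πμN') = √2/√(12π) · √(μq) N' √N'`
        have e1 : Real.sqrt (2 * q) = Real.sqrt 2 * Real.sqrt q := Real.sqrt_mul (by norm_num) _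
        have e2 : Real.sqrt (12 * π * μ * (N + s)) = Real.sqrt (12 * π) * (Real.sqrt μ * Real.sqrt (N + s)) := by
          rw [show 12 * π * μ * (N + s) = (12 * π) * (μ * (N + s)) by ring, Real.sqrt_mul (by positivity),
            Real.sqrt_mul hμ.le]
        have e3 : Real.sqrt (μ * q) = Real.sqrt μ * Real.sqrt q := Real.sqrt_mul hμ.le _
        rw [e1, e2, e3]
        have hsμ : 0 < Real.sqrt μ := Real.sqrt_pos.2 hμ
        have hsq : 0 < Real.sqrt q := Real.sqrt_pos.2 hq0
        have hsN : 0 < Real.sqrt (N + s) := Real.sqrt_pos.2 hN'0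
        have hs12 : 0 < Real.sqrt (12 * π) := Real.sqrt_pos.2 (by positivity)
        field_simp
        have hqq : Real.sqrt q ^ 2 = q := Real.sq_sqrt hq0.le
        have hμμ : Real.sqrt μ ^ 2 = μ := Real.sq_sqrt hμ.le
        have hNN : Real.sqrt (N + s) ^ 2 = N + s := Real.sq_sqrt hN'0.le
        nlinarith [hqq, hμμ, hNN]
    _ ≤ 15 * Real.sqrt (μ * q) * (N + s) * Real.sqrt (N + s) := by
        have hnum : 60 * Real.sqrt 2 / Real.sqrt (12 * π) ≤ 15 := by
          rw [div_le_iff₀ (Real.sqrt_pos.2 (by positivity))]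
          have hs2 : Real.sqrt 2 ≤ 3 / 2 := by rw [Real.sqrt_le_left (by norm_num)]; norm_num
          have hs12 : 6 ≤ Real.sqrt (12 * π) := by
            rw [Real.le_sqrt (by norm_num) (by positivity)]; nlinarith [Real.pi_gt_three]
          nlinarith
        have : 0 ≤ Real.sqrt (μ * q) * (N + s) * Real.sqrt (N + s) := by positivity
        nlinarith



end PerBlock

/-! ### Envelope bounds for the factors of the family estimate

Throughout: `μlo` is a lower bound for `μ = T/(3m³)` on the blocks (`μlo = T/(3M³)`), with
`2/(3NR²) ≤ μlo` (from `NTR² ≤ 8M³`… precisely `T/M³ ≥ 2/(NR²)`), `Nlo ≥ 0.09 N` a lower bound for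
`N' = L + s`, and the family has denominators `q ∈ (Q, 2Q]`. -/

/-- `kappa μ q = (2/(3q)) / √(3μq)` for `μ, q ≠ 0`. [folklore] -/
theorem kappa_eq_div {μ q : ℝ} (hμ : μ ≠ 0) (hq : q ≠ 0) : kappa μ q = 2 / (3 * q) / Real.sqrt (3 * μ * q) := by
  unfold kappa
  field_simp

/-- **Size of `κ`:** for `μ ≥ 2/(3NR²)` and `q ≥ Q > 0`: `kappa μ q ≤ (1/2) R N^{1/2} /(Q Q^{1/2})`.
[folklore] -/
theorem kappa_le {μ q Q N R : ℝ} (hN : 0 < N) (hR : 0 < R) (hQ : 0 < Q) (hμ : 2 / (3 * N * R ^ 2) ≤ μ)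
    (hq : Q ≤ q) :
    kappa μ q ≤ 1 / 2 * R * Real.sqrt N / (Q * Real.sqrt Q) := by
  have hμ0 : 0 < μ := lt_of_lt_of_le (by positivity) hμ
  have hq0 : 0 < q := hQ.trans_le hq
  rw [kappa_eq_div hμ0.ne' hq0.ne']
  have h3 : 2 * Q / (N * R ^ 2) ≤ 3 * μ * q := by
    have : 2 * Q / (N * R ^ 2) = 3 * (2 / (3 * N * R ^ 2)) * Q := by field_simp
    rw [this]
    exact mul_le_mul (mul_le_mul_of_nonneg_left hμ (by norm_num)) hq hQ.le (by positivity)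
  have hs0 : 0 < Real.sqrt (2 * Q / (N * R ^ 2)) := Real.sqrt_pos.2 (by positivity)
  have hsval : Real.sqrt (2 * Q / (N * R ^ 2)) = Real.sqrt 2 * Real.sqrt Q / (Real.sqrt N * R) := by
    rw [Real.sqrt_div (by positivity), Real.sqrt_mul (by norm_num), Real.sqrt_mul hN.le, Real.sqrt_sq hR.le]
  have hsQ : 0 < Real.sqrt Q := Real.sqrt_pos.2 hQ
  have hsN : 0 < Real.sqrt N := Real.sqrt_pos.2 hN
  calc 2 / (3 * q) / Real.sqrt (3 * μ * q) ≤ 2 / (3 * Q) / Real.sqrt (2 * Q / (N * R ^ 2)) := by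
        gcongr
    _ = 2 / (3 * Q) * (Real.sqrt N * R) / (Real.sqrt 2 * Real.sqrt Q) := by
        rw [hsval]; field_simp
    _ ≤ 1 / 2 * R * Real.sqrt N / (Q * Real.sqrt Q) := by
        have hs2 : 4 / 3 ≤ Real.sqrt 2 := by rw [Real.le_sqrt (by norm_num) (by norm_num)]; norm_num
        rw [div_le_div_iff₀ (by positivity) (by positivity)]
        have e : 2 / (3 * Q) * (Real.sqrt N * R) * (Q * Real.sqrt Q) = 2 / 3 * (R * Real.sqrt N * Real.sqrt Q) := by
          field_simp
        rw [e]
        nlinarith [mul_pos (mul_pos hR hsN) hsQ]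

/-- **Lower bound for `H₀`:** `μ q N'² ≥ (2/(3NR²)) Q (9N/100)² = (27/5000) QN/R²`. [folklore] -/
theorem H0_ge {μ q Q N R Nlo N' : ℝ} (hN : 0 < N) (hQ : 0 < Q) (hμ : 2 / (3 * N * R ^ 2) ≤ μ)
    (hq : Q ≤ q) (hNlo : 9 / 100 * N ≤ Nlo) (hN' : Nlo ≤ N') (hR : 0 < R) :
    27 / 5000 * (Q * N / R ^ 2) ≤ μ * q * N' ^ 2 := by
  have hμ0 : 0 < μ := lt_of_lt_of_le (by positivity) hμ
  have h1 : (9 / 100 * N) ^ 2 ≤ N' ^ 2 := by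
    have : 9 / 100 * N ≤ N' := hNlo.trans hN'
    exact pow_le_pow_left₀ (by positivity) this 2
  calc 27 / 5000 * (Q * N / R ^ 2) = 2 / (3 * N * R ^ 2) * Q * (9 / 100 * N) ^ 2 := by field_simp; ring
    _ ≤ μ * q * N' ^ 2 := by
        apply mul_le_mul (mul_le_mul hμ hq hQ.le hμ0.le) h1 (by positivity) (mul_nonneg hμ0.le (hQ.le.trans hq))

/-- **The Abel factor is bounded on the sieve arcs:** if `R⁴ ≤ Q³N`, `μ ≥ 2/(3NR²)`, `q ≥ Q` and
`H₀ ≥ max(1, (27/5000) QN/R²)` then `kappa μ q / (H₀ √H₀) ≤ 1500`. [folklore] -/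
theorem abel_factor_le {μ q Q N R H₀ : ℝ} (hN : 0 < N) (hR : 0 < R) (hQ : 0 < Q)
    (hμ : 2 / (3 * N * R ^ 2) ≤ μ) (hq : Q ≤ q) (hH₀ : 27 / 5000 * (Q * N / R ^ 2) ≤ H₀) (hH₀1 : 1 ≤ H₀)
    (hsieve : R ^ 4 ≤ Q ^ 3 * N) :
    kappa μ q / (H₀ * Real.sqrt H₀) ≤ 1500 := by
  have hκ := kappa_le hN hR hQ hμ hq
  have hH₀0 : 0 < H₀ := by linarith
  have hsH : 0 < Real.sqrt H₀ := Real.sqrt_pos.2 hH₀0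
  have hsQ : 0 < Real.sqrt Q := Real.sqrt_pos.2 hQ
  have hsN : 0 < Real.sqrt N := Real.sqrt_pos.2 hN
  rw [div_le_iff₀ (by positivity)]
  refine hκ.trans ?_
  rw [div_le_iff₀ (by positivity)]
  -- square-root coordinates `u = √H₀`, `a = √Q`, `b = √N`
  set u := Real.sqrt H₀ with huu
  set a := Real.sqrt Q with haa
  set b := Real.sqrt N with hbb
  have hu : u ^ 2 = H₀ := Real.sq_sqrt hH₀0.le
  have ha : a ^ 2 = Q := Real.sq_sqrt hQ.le
  have hb : b ^ 2 = N := Real.sq_sqrt hN.le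
  -- `u R ≥ 0.07 a b`
  have hub : 7 / 100 * (a * b) ≤ u * R := by
    have h1 : (7 / 100 * (a * b)) ^ 2 ≤ (u * R) ^ 2 := by
      have : (7 / 100 * (a * b)) ^ 2 = 49 / 10000 * (a ^ 2 * b ^ 2) := by ring
      rw [this, mul_pow, hu, ha, hb]
      have h2 : 27 / 5000 * (Q * N / R ^ 2) * R ^ 2 ≤ H₀ * R ^ 2 := mul_le_mul_of_nonneg_right hH₀ (by positivity)
      have h3 : 27 / 5000 * (Q * N / R ^ 2) * R ^ 2 = 27 / 5000 * (Q * N) := by field_simp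
      nlinarith [h2, h3, mul_pos hQ hN]
    exact (pow_le_pow_iff_left₀ (by positivity) (by positivity) two_ne_zero).1 h1
  -- `R⁴ ≤ a⁶ b²`
  have hsv : R ^ 4 ≤ a ^ 6 * b ^ 2 := by
    rw [hb, show a ^ 6 = (a ^ 2) ^ 3 by ring, ha]; exact hsieve
  -- chain: `R b · R³ = R⁴ b ≤ a⁶ b³ = (ab)³ a³ ≤ (100/7)³ (uR)³ a³`
  have h3 : (7 / 100 * (a * b)) ^ 3 ≤ (u * R) ^ 3 := pow_le_pow_left₀ (by positivity) hub 3
  have key : R * b * R ^ 3 ≤ (100 / 7) ^ 3 * (u ^ 3 * a ^ 3) * R ^ 3 := by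
    calc R * b * R ^ 3 = R ^ 4 * b := by ring
      _ ≤ a ^ 6 * b ^ 2 * b := mul_le_mul_of_nonneg_right hsv hsN.le
      _ = (a * b) ^ 3 * a ^ 3 := by ring
      _ = (100 / 7) ^ 3 * (7 / 100 * (a * b)) ^ 3 * a ^ 3 := by ring
      _ ≤ (100 / 7) ^ 3 * (u * R) ^ 3 * a ^ 3 := by gcongr
      _ = (100 / 7) ^ 3 * (u ^ 3 * a ^ 3) * R ^ 3 := by ring
  have hR3 : 0 < R ^ 3 := by positivity
  have hRb := le_of_mul_le_mul_right key hR3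
  have hnum : ((100 : ℝ) / 7) ^ 3 ≤ 2916 := by norm_num
  have hua : 0 < u ^ 3 * a ^ 3 := by positivity
  -- goal: `1/2 R b ≤ 1500 (H₀ u) (Q a)`; `H₀ u · Q a = u³ a³`
  have e : 1500 * (H₀ * u) * (Q * a) = 1500 * (u ^ 3 * a ^ 3) := by rw [← hu, ← ha]; ring
  rw [e]
  nlinarith [hRb, hnum, hua]

/-- **Prefactor bound:** `(μ q N')^{-1/2} ≤ (13/3) R Q^{-1/2}` for `μ ≥ 2/(3NR²)`, `q ≥ Q`, `N' ≥ 9N/100`.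
[folklore] -/
theorem inv_sqrt_le {μ q Q N R N' : ℝ} (hN : 0 < N) (hR : 0 < R) (hQ : 0 < Q) (hμ : 2 / (3 * N * R ^ 2) ≤ μ)
    (hq : Q ≤ q) (hN' : 9 / 100 * N ≤ N') :
    1 / Real.sqrt (μ * q * N') ≤ 13 / 3 * R / Real.sqrt Q := by
  have hμ0 : 0 < μ := lt_of_lt_of_le (by positivity) hμ
  have hq0 : 0 < q := hQ.trans_le hq
  have hN'0 : 0 < N' := lt_of_lt_of_le (by positivity) hN'
  have hlow : 3 / 50 * (Q / R ^ 2) ≤ μ * q * N' := by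
    calc 3 / 50 * (Q / R ^ 2) = 2 / (3 * N * R ^ 2) * Q * (9 / 100 * N) := by field_simp; ring
      _ ≤ μ * q * N' := mul_le_mul (mul_le_mul hμ hq hQ.le hμ0.le) hN' (by positivity) (by positivity)
  have hs := Real.sqrt_le_sqrt hlow
  have hs0 : 0 < Real.sqrt (3 / 50 * (Q / R ^ 2)) := Real.sqrt_pos.2 (by positivity)
  have hsQ : 0 < Real.sqrt Q := Real.sqrt_pos.2 hQ
  calc 1 / Real.sqrt (μ * q * N') ≤ 1 / Real.sqrt (3 / 50 * (Q / R ^ 2)) := by gcongr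
    _ = R / (Real.sqrt (3 / 50) * Real.sqrt Q) := by
        rw [Real.sqrt_mul (by norm_num), Real.sqrt_div hQ.le, Real.sqrt_sq hR.le]
        field_simp
    _ ≤ 13 / 3 * R / Real.sqrt Q := by
        have h350 : 3 / 13 ≤ Real.sqrt (3 / 50) := by
          rw [Real.le_sqrt (by norm_num) (by norm_num)]; norm_num
        rw [div_le_div_iff₀ (by positivity) hsQ]
        have : 0 < R * Real.sqrt Q := by positivity
        nlinarith [h350, this]

/-- **The prefactor of `norm_mainTerm5_le` on the sieve arcs:**
`2(1 + 5κ/(H₀√H₀))/√(μqN') ≤ 66000 R/√Q`. [folklore] -/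
theorem prefactor_le {μ q Q N R N' : ℝ} (hN : 0 < N) (hR : 0 < R) (hQ : 0 < Q) (hμ : 2 / (3 * N * R ^ 2) ≤ μ)
    (hq : Q ≤ q) (hN' : 9 / 100 * N ≤ N') (hH₀1 : 1 ≤ μ * q * N' ^ 2) (hsieve : R ^ 4 ≤ Q ^ 3 * N) :
    2 * (1 + 5 * kappa μ q / (μ * q * N' ^ 2 * Real.sqrt (μ * q * N' ^ 2))) / Real.sqrt (μ * q * N') ≤
      66000 * R / Real.sqrt Q := by
  have hH₀ := H0_ge hN hQ hμ hq hN' le_rfl hR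
  have hab := abel_factor_le hN hR hQ hμ hq hH₀ hH₀1 hsieve
  have hinv := inv_sqrt_le hN hR hQ hμ hq hN'
  have hμ0 : 0 < μ := lt_of_lt_of_le (by positivity) hμ
  have hq0 : 0 < q := hQ.trans_le hq
  have hN'0 : 0 < N' := lt_of_lt_of_le (by positivity) hN'
  have hs : 0 < Real.sqrt (μ * q * N') := Real.sqrt_pos.2 (by positivity)
  have h1 : 1 + 5 * kappa μ q / (μ * q * N' ^ 2 * Real.sqrt (μ * q * N' ^ 2)) ≤ 7501 := by
    rw [mul_div_assoc]; linarith
  calc 2 * (1 + 5 * kappa μ q / (μ * q * N' ^ 2 * Real.sqrt (μ * q * N' ^ 2))) / Real.sqrt (μ * q * N')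
      = 2 * (1 + 5 * kappa μ q / (μ * q * N' ^ 2 * Real.sqrt (μ * q * N' ^ 2))) * (1 / Real.sqrt (μ * q * N')) := by
        ring
    _ ≤ 2 * 7501 * (13 / 3 * R / Real.sqrt Q) := by
        have h0 : 0 ≤ 1 + 5 * kappa μ q / (μ * q * N' ^ 2 * Real.sqrt (μ * q * N' ^ 2)) := by
          have := kappa_pos hμ0 hq0; positivity
        have := mul_le_mul (mul_le_mul_of_nonneg_left h1 zero_le_two) hinv (by positivity) (by positivity)
        linarith
    _ ≤ 66000 * R / Real.sqrt Q := by
        have : 0 ≤ R / Real.sqrt Q := by positivity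
        rw [show 2 * 7501 * (13 / 3 * R / Real.sqrt Q) = (2 * 7501 * 13 / 3) * (R / Real.sqrt Q) by ring,
          show 66000 * R / Real.sqrt Q = 66000 * (R / Real.sqrt Q) by ring]
        exact mul_le_mul_of_nonneg_right (by norm_num) this

/-! ### Box factors -/

/-- `√X · R ≥ (7/100) √Q √N` whenever `X ≥ (27/5000) QN/R²`. [folklore] -/
theorem sqrt_mul_ge {X Q N R : ℝ} (hN : 0 < N) (hR : 0 < R) (hQ : 0 < Q) (hX : 27 / 5000 * (Q * N / R ^ 2) ≤ X) :
    7 / 100 * (Real.sqrt Q * Real.sqrt N) ≤ Real.sqrt X * R := by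
  have hX0 : 0 < X := lt_of_lt_of_le (by positivity) hX
  have h1 : (7 / 100 * (Real.sqrt Q * Real.sqrt N)) ^ 2 ≤ (Real.sqrt X * R) ^ 2 := by
    rw [mul_pow, mul_pow, mul_pow, Real.sq_sqrt hQ.le, Real.sq_sqrt hN.le, Real.sq_sqrt hX0.le]
    have h2 : 27 / 5000 * (Q * N / R ^ 2) * R ^ 2 ≤ X * R ^ 2 := mul_le_mul_of_nonneg_right hX (by positivity)
    have h3 : 27 / 5000 * (Q * N / R ^ 2) * R ^ 2 = 27 / 5000 * (Q * N) := by field_simp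
    nlinarith [mul_pos hQ hN]
  exact (pow_le_pow_iff_left₀ (by positivity) (by positivity) two_ne_zero).1 h1

/-- `κ ≤ 8 (R²/Q²) √X` for `κ ≤ R√N/(2Q√Q)` and `X ≥ (27/5000) QN/R²`. [folklore] -/
theorem kappa_le_mul_sqrt {κ X Q N R : ℝ} (hN : 0 < N) (hR : 0 < R) (hQ : 0 < Q)
    (hκ : κ ≤ 1 / 2 * R * Real.sqrt N / (Q * Real.sqrt Q)) (hX : 27 / 5000 * (Q * N / R ^ 2) ≤ X) :
    κ ≤ 8 * (R ^ 2 / Q ^ 2) * Real.sqrt X := by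
  have hlow := sqrt_mul_ge hN hR hQ hX
  have hsQ : 0 < Real.sqrt Q := Real.sqrt_pos.2 hQ
  have hsN : 0 < Real.sqrt N := Real.sqrt_pos.2 hN
  have hX0 : 0 < X := lt_of_lt_of_le (by positivity) hX
  refine hκ.trans ?_
  rw [div_le_iff₀ (by positivity)]
  have hQQ : Real.sqrt Q * Real.sqrt Q = Q := Real.mul_self_sqrt hQ.le
  have e : 8 * (R ^ 2 / Q ^ 2) * Real.sqrt X * (Q * Real.sqrt Q) = 8 * R * (Real.sqrt X * R) * Real.sqrt Q / Q := by
    field_simp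
  rw [e, le_div_iff₀ hQ]
  calc 1 / 2 * R * Real.sqrt N * Q = (1 / 2 * (100 / 7)) * R * (7 / 100 * (Real.sqrt Q * Real.sqrt N)) * Real.sqrt Q := by
        linear_combination (-(1 / 2) * R * Real.sqrt N) * hQQ
    _ ≤ (1 / 2 * (100 / 7)) * R * (Real.sqrt X * R) * Real.sqrt Q := by gcongr
    _ ≤ 8 * R * (Real.sqrt X * R) * Real.sqrt Q := by
        have : 0 ≤ R * (Real.sqrt X * R) * Real.sqrt Q := by positivity
        nlinarith

/-- **`max(1, X₃/√H) ≤ 9 max(1, R²/Q²)`** for `X₃ = max(κ, H^{-1/2})`, `κ ≤ R√N/(2Q√Q)`,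
`H ≥ (27/5000) QN/R²`, `H ≥ 1`. [folklore] -/
theorem mx_le {κ H Q N R : ℝ} (hN : 0 < N) (hR : 0 < R) (hQ : 0 < Q)
    (hκ : κ ≤ 1 / 2 * R * Real.sqrt N / (Q * Real.sqrt Q)) (hH1 : 1 ≤ H) (hH : 27 / 5000 * (Q * N / R ^ 2) ≤ H) :
    max 1 (max κ (1 / Real.sqrt H) / Real.sqrt H) ≤ 9 * max 1 (R ^ 2 / Q ^ 2) := by
  have hH0 : 0 < H := by linarith
  have hsH : 0 < Real.sqrt H := Real.sqrt_pos.2 hH0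
  have hsH1 : 1 ≤ Real.sqrt H := Real.one_le_sqrt.2 hH1
  have hm1 : (1 : ℝ) ≤ max 1 (R ^ 2 / Q ^ 2) := le_max_left _ _
  have hRQ : R ^ 2 / Q ^ 2 ≤ max 1 (R ^ 2 / Q ^ 2) := le_max_right _ _
  refine max_le (by linarith) ?_
  rw [div_le_iff₀ hsH]
  refine max_le ?_ ?_
  · calc κ ≤ 8 * (R ^ 2 / Q ^ 2) * Real.sqrt H := kappa_le_mul_sqrt hN hR hQ hκ hH
      _ ≤ 9 * max 1 (R ^ 2 / Q ^ 2) * Real.sqrt H := by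
          nlinarith [mul_le_mul_of_nonneg_right hRQ hsH.le, mul_nonneg (by linarith : (0:ℝ) ≤ max 1 (R ^ 2 / Q ^ 2)) hsH.le]
  · calc 1 / Real.sqrt H ≤ 1 := by rw [div_le_one hsH]; exact hsH1
      _ ≤ 9 * max 1 (R ^ 2 / Q ^ 2) * Real.sqrt H := by nlinarith

/-- **The fifth box factor `1 + 24X₅/√(M₀+1) ≤ 19 max(1, R²/Q²)`** for `X₅ = (3/32)κ`,
`κ ≤ R√N/(2Q√Q)`, `M₀ + 1 ≥ (27/5000) QN/R²`. [folklore] -/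
theorem box5_le {κ M₀' Q N R : ℝ} (hN : 0 < N) (hR : 0 < R) (hQ : 0 < Q)
    (hκ : κ ≤ 1 / 2 * R * Real.sqrt N / (Q * Real.sqrt Q)) (hM₀ : 27 / 5000 * (Q * N / R ^ 2) ≤ M₀') :
    1 + 24 * (3 / 32 * κ) / Real.sqrt M₀' ≤ 19 * max 1 (R ^ 2 / Q ^ 2) := by
  have hM0 : 0 < M₀' := lt_of_lt_of_le (by positivity) hM₀
  have hsM : 0 < Real.sqrt M₀' := Real.sqrt_pos.2 hM0
  have hm1 : (1 : ℝ) ≤ max 1 (R ^ 2 / Q ^ 2) := le_max_left _ _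
  have hRQ : R ^ 2 / Q ^ 2 ≤ max 1 (R ^ 2 / Q ^ 2) := le_max_right _ _
  have hk := kappa_le_mul_sqrt hN hR hQ hκ hM₀
  have hmain : 24 * (3 / 32 * κ) / Real.sqrt M₀' ≤ 18 * (R ^ 2 / Q ^ 2) := by
    rw [div_le_iff₀ hsM]
    calc 24 * (3 / 32 * κ) = 9 / 4 * κ := by ring
      _ ≤ 9 / 4 * (8 * (R ^ 2 / Q ^ 2) * Real.sqrt M₀') := by gcongr
      _ = 18 * (R ^ 2 / Q ^ 2) * Real.sqrt M₀' := by ring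
  calc 1 + 24 * (3 / 32 * κ) / Real.sqrt M₀' ≤ 1 + 18 * (R ^ 2 / Q ^ 2) := by linarith
    _ ≤ max 1 (R ^ 2 / Q ^ 2) + 18 * max 1 (R ^ 2 / Q ^ 2) := by gcongr
    _ = 19 * max 1 (R ^ 2 / Q ^ 2) := by ring

/-! ### Counting envelopes -/

/-- **Near count envelope:** `Q((2Q+1)(Λ+2η)+1)(2η/δ+1) ≤ 384 (M/N)(Q/R)²` when `Λ ≤ 3T/M²`,
`0 ≤ η ≤ 1`, `2η/δ ≤ 2`, `T/M² ≥ 1`, `NTR² ≤ 8M³`, `Q ≥ 1`. [folklore] -/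
theorem near_env {Q Λ η δ T M N R : ℝ} (hQ : 1 ≤ Q) (hΛ0 : 0 ≤ Λ) (hΛ : Λ ≤ 3 * (T / M ^ 2)) (hη0 : 0 ≤ η)
    (hη : η ≤ 1) (hδ : 2 * η / δ ≤ 2) (hδ0 : 0 ≤ 2 * η / δ) (hTM : 1 ≤ T / M ^ 2) (hM : 0 < M) (hN : 0 < N)
    (hR : 0 < R) (hrel : N * T * R ^ 2 ≤ 8 * M ^ 3) :
    Q * ((2 * Q + 1) * (Λ + 2 * η) + 1) * (2 * η / δ + 1) ≤ 384 * (M / N) * (Q / R) ^ 2 := by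
  have hTM' : T / M ^ 2 ≤ 8 * (M / N) / R ^ 2 := by
    rw [div_le_div_iff₀ (by positivity) (by positivity)]
    have : T * R ^ 2 = (N * T * R ^ 2) / N := by field_simp
    calc T * R ^ 2 = (N * T * R ^ 2) / N := this
      _ ≤ 8 * M ^ 3 / N := by gcongr
      _ = 8 * (M / N) * M ^ 2 := by field_simp
  have h1 : (2 * Q + 1) * (Λ + 2 * η) + 1 ≤ 16 * Q * (T / M ^ 2) := by
    have : (2 * Q + 1) * (Λ + 2 * η) ≤ 3 * Q * (5 * (T / M ^ 2)) := by
      apply mul_le_mul (by linarith) (by linarith) (by positivity) (by positivity)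
    nlinarith
  have h2 : 2 * η / δ + 1 ≤ 3 := by linarith
  calc Q * ((2 * Q + 1) * (Λ + 2 * η) + 1) * (2 * η / δ + 1) ≤ Q * (16 * Q * (T / M ^ 2)) * 3 := by
        apply mul_le_mul (mul_le_mul_of_nonneg_left h1 (by linarith)) h2 (by linarith) (by positivity)
    _ = 48 * Q ^ 2 * (T / M ^ 2) := by ring
    _ ≤ 48 * Q ^ 2 * (8 * (M / N) / R ^ 2) := by gcongr
    _ = 384 * (M / N) * (Q / R) ^ 2 := by field_simp; norm_num

/-- **Far count envelope:** with `η = 1/(20R²)`, `δ = Tℓ/(2M³)`, `ℓ ≥ N/20`, `Λ ≤ 3T/M²`, `T/M² ≥ 1`,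
`NTR² ≤ 8M³`, `Q ≥ 1`:
`1/(η(Q+1))((2Λ+4)/((Q+1)δ) + 2) + Λ/(η(Q+1))² ≤ 17640 max(MR²/(NQ²), R²/Q)`. [folklore] -/
theorem far_env {Q Λ T M N R ℓ : ℝ} (hQ : 1 ≤ Q) (hΛ0 : 0 ≤ Λ) (hΛ : Λ ≤ 3 * (T / M ^ 2)) (hTM : 1 ≤ T / M ^ 2)
    (hM : 0 < M) (hN : 0 < N) (hR : 0 < R) (hT : 0 < T) (hℓ : N / 20 ≤ ℓ) (hrel : N * T * R ^ 2 ≤ 8 * M ^ 3) :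
    1 / (1 / (20 * R ^ 2) * (Q + 1)) * ((2 * Λ + 4) / ((Q + 1) * (T * ℓ / (2 * M ^ 3))) + 2) +
        Λ / (1 / (20 * R ^ 2) * (Q + 1)) ^ 2 ≤
      17640 * max (M * R ^ 2 / (N * Q ^ 2)) (R ^ 2 / Q) := by
  have hQ0 : 0 < Q := by linarith
  have hℓ0 : 0 < ℓ := lt_of_lt_of_le (by positivity) hℓ
  have hm1 : M * R ^ 2 / (N * Q ^ 2) ≤ max (M * R ^ 2 / (N * Q ^ 2)) (R ^ 2 / Q) := le_max_left _ _
  have hm2 : R ^ 2 / Q ≤ max (M * R ^ 2 / (N * Q ^ 2)) (R ^ 2 / Q) := le_max_right _ _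
  have hmx0 : 0 ≤ max (M * R ^ 2 / (N * Q ^ 2)) (R ^ 2 / Q) := le_trans (by positivity) hm1
  -- `1/(η(Q+1)) ≤ 20R²/Q`
  have hA : 1 / (1 / (20 * R ^ 2) * (Q + 1)) ≤ 20 * R ^ 2 / Q := by
    rw [show 1 / (1 / (20 * R ^ 2) * (Q + 1)) = 20 * R ^ 2 / (Q + 1) by field_simp]
    exact div_le_div_of_nonneg_left (by positivity) hQ0 (by linarith)
  have hA0 : 0 ≤ 1 / (1 / (20 * R ^ 2) * (Q + 1)) := by positivity
  -- `(2Λ+4)/((Q+1)δ) ≤ 400 M/(QN)`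
  have hB : (2 * Λ + 4) / ((Q + 1) * (T * ℓ / (2 * M ^ 3))) ≤ 400 * M / (Q * N) := by
    have hnum : 2 * Λ + 4 ≤ 10 * (T / M ^ 2) := by linarith
    have hden : Q * (T * (N / 20) / (2 * M ^ 3)) ≤ (Q + 1) * (T * ℓ / (2 * M ^ 3)) := by
      apply mul_le_mul (by linarith) _ (by positivity) (by positivity)
      gcongr
    calc (2 * Λ + 4) / ((Q + 1) * (T * ℓ / (2 * M ^ 3))) ≤ 10 * (T / M ^ 2) / (Q * (T * (N / 20) / (2 * M ^ 3))) := by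
          gcongr
      _ = 400 * M / (Q * N) := by field_simp; ring
  -- `Λ/(η(Q+1))² ≤ 3(T/M²) 400R⁴/Q² ≤ 9600 MR²/(NQ²)`
  have hTM' : T / M ^ 2 ≤ 8 * M / (N * R ^ 2) := by
    rw [div_le_div_iff₀ (by positivity) (by positivity)]
    nlinarith [hrel, pow_pos hM 2]
  have hC : Λ / (1 / (20 * R ^ 2) * (Q + 1)) ^ 2 ≤ 9600 * (M * R ^ 2 / (N * Q ^ 2)) := by
    have h1 : Λ / (1 / (20 * R ^ 2) * (Q + 1)) ^ 2 = Λ * (1 / (1 / (20 * R ^ 2) * (Q + 1))) ^ 2 := by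
      field_simp
    rw [h1]
    calc Λ * (1 / (1 / (20 * R ^ 2) * (Q + 1))) ^ 2 ≤ (3 * (T / M ^ 2)) * (20 * R ^ 2 / Q) ^ 2 := by
          apply mul_le_mul hΛ (pow_le_pow_left₀ hA0 hA 2) (by positivity) (by positivity)
      _ ≤ (3 * (8 * M / (N * R ^ 2))) * (20 * R ^ 2 / Q) ^ 2 := by gcongr
      _ = 9600 * (M * R ^ 2 / (N * Q ^ 2)) := by field_simp; ring
  -- combine
  have hfirst : 1 / (1 / (20 * R ^ 2) * (Q + 1)) * ((2 * Λ + 4) / ((Q + 1) * (T * ℓ / (2 * M ^ 3))) + 2)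
      ≤ (20 * R ^ 2 / Q) * (400 * M / (Q * N) + 2) := by
    apply mul_le_mul hA (by linarith) (by positivity) (by positivity)
  have e1 : (20 * R ^ 2 / Q) * (400 * M / (Q * N) + 2) = 8000 * (M * R ^ 2 / (N * Q ^ 2)) + 40 * (R ^ 2 / Q) := by
    field_simp; ring
  calc _ ≤ (20 * R ^ 2 / Q) * (400 * M / (Q * N) + 2) + 9600 * (M * R ^ 2 / (N * Q ^ 2)) := add_le_add hfirst hC
    _ = 17600 * (M * R ^ 2 / (N * Q ^ 2)) + 40 * (R ^ 2 / Q) := by rw [e1]; ring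
    _ ≤ 17600 * max (M * R ^ 2 / (N * Q ^ 2)) (R ^ 2 / Q) + 40 * max (M * R ^ 2 / (N * Q ^ 2)) (R ^ 2 / Q) := by
        gcongr
    _ = 17640 * max (M * R ^ 2 / (N * Q ^ 2)) (R ^ 2 / Q) := by ring



/-! ### Envelope for `Δ₂ = delta2 T A Q η H` -/

/-- The first part of `Δ₂`: `c₁ G₀ (1/(12 H^{3/2}))/kap T G₀ / √(AQ) = (c₁/16) G₀√G₀ /(H^{3/2} T^{1/4})`
squared is `(c₁/16)² G₀³/(H³ √T)`. We bound it by `(R²/N²)²` up to a constant. [folklore] -/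
theorem delta2_first_sq_le {T A Q H M N R : ℝ} (hT : 0 < T) (hA : 0 < A) (hQ : 0 < Q) (hH : 0 < H)
    (hM : 0 < M) (hN : 0 < N) (hR : 0 < R)
    (hAQ : A ≤ 9 / 2 * (T / M ^ 2) * Q) (hrel : N * T * R ^ 2 ≤ 8 * M ^ 3) (hHlo : 81 / 1250 * (Q * N / R ^ 2) ≤ H) :
    (2 / 3 * 9 ^ 6 * (Real.sqrt (A * Q) / 2) * ((1 / (12 * H ^ (3 / 2 : ℝ))) / kap T (Real.sqrt (A * Q) / 2))
        / Real.sqrt (A * Q)) ^ 2 ≤ (3 * 10 ^ 13) * (R ^ 2 / N ^ 2) ^ 2 := by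
  set G₀ : ℝ := Real.sqrt (A * Q) / 2 with hG₀
  have hsAQ : 0 < Real.sqrt (A * Q) := Real.sqrt_pos.2 (by positivity)
  have hG₀pos : 0 < G₀ := by rw [hG₀]; positivity
  have hκ := kap_pos hT hG₀pos
  have hck := cube_mul_kap_sq T hG₀pos
  -- rewrite the expression as `X := c G₀ /(12 H^{3/2} kap) / (2 G₀) = c/(24 H^{3/2} kap)`
  have hsq2 : Real.sqrt (A * Q) = 2 * G₀ := by rw [hG₀]; ring
  rw [hsq2, show H ^ (3 / 2 : ℝ) = H * Real.sqrt H by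
    rw [show (3 / 2 : ℝ) = 1 + 1 / 2 by norm_num, Real.rpow_add' hH.le (by norm_num), Real.rpow_one, Real.sqrt_eq_rpow]]
  have e : 2 / 3 * 9 ^ 6 * G₀ * (1 / (12 * (H * Real.sqrt H)) / kap T G₀) / (2 * G₀) =
      (9 ^ 6 / 36) / (H * Real.sqrt H * kap T G₀) := by
    field_simp
    ring
  rw [e, div_pow]
  -- `(H √H κ)² = H³ κ²` and `κ² = (4/9)√T / G₀³`
  have hsH : 0 < Real.sqrt H := Real.sqrt_pos.2 hH
  have hHH : Real.sqrt H ^ 2 = H := Real.sq_sqrt hH.le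
  have hden : (H * Real.sqrt H * kap T G₀) ^ 2 = H ^ 3 * (4 / 9 * Real.sqrt T) / G₀ ^ 3 := by
    rw [mul_pow, mul_pow, hHH, eq_div_iff (by positivity), ← hck]; ring
  rw [hden, div_div_eq_mul_div]
  -- goal: `(9⁶/36)² G₀³ / (H³ (4/9) √T) ≤ C (R²/N²)²`
  rw [div_le_iff₀ (by positivity)]
  -- bound `G₀³ = (AQ)√(AQ)/8 ≤ ...`: `AQ ≤ (9/2)(T/M²) Q²`
  have hAQ' : A * Q ≤ 9 / 2 * (T / M ^ 2) * Q ^ 2 := by nlinarith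
  have hG₀3 : G₀ ^ 3 = A * Q * Real.sqrt (A * Q) / 8 := by
    rw [hG₀, div_pow, show Real.sqrt (A * Q) ^ 3 = Real.sqrt (A * Q) ^ 2 * Real.sqrt (A * Q) by ring,
      Real.sq_sqrt (by positivity)]; ring
  have hsT : 0 < Real.sqrt T := Real.sqrt_pos.2 hT
  have hTT : Real.sqrt T ^ 2 = T := Real.sq_sqrt hT.le
  -- `√(AQ) ≤ √(9/2) √T Q / M ≤ (3/√2)... use `√(AQ) ≤ 3 √T Q / M` (since 9/2 ≤ 9)
  have hsAQle : Real.sqrt (A * Q) ≤ 3 * Real.sqrt T * Q / M := by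
    have hAM : A * M ^ 2 ≤ 9 / 2 * T * Q := by
      have := hAQ
      rw [show 9 / 2 * (T / M ^ 2) * Q = (9 / 2 * T * Q) / M ^ 2 by ring, le_div_iff₀ (by positivity)] at this
      exact this
    have h1 : A * Q ≤ (3 * Real.sqrt T * Q / M) ^ 2 := by
      rw [div_pow, mul_pow, mul_pow, hTT]
      rw [le_div_iff₀ (by positivity)]
      nlinarith [hAM, hQ]
    calc Real.sqrt (A * Q) ≤ Real.sqrt ((3 * Real.sqrt T * Q / M) ^ 2) := Real.sqrt_le_sqrt h1
      _ = 3 * Real.sqrt T * Q / M := Real.sqrt_sq (by positivity)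
  -- `T/M³ ≤ 8/(N R²)` in the form `T R² N ≤ 8 M³`
  -- `H³ ≥ (81/1250)³ (QN/R²)³`
  have hH3 : (81 / 1250 * (Q * N / R ^ 2)) ^ 3 ≤ H ^ 3 := pow_le_pow_left₀ (by positivity) hHlo 3
  -- Assemble: LHS = (9⁶/36)² G₀³ ≤ (9⁶/36)² (9/2)(T/M²)Q² · 3√T Q/M / 8 = K₁ T√T Q³/M³
  have hL : (9 ^ 6 / 36 : ℝ) ^ 2 * G₀ ^ 3 ≤ (9 ^ 6 / 36 : ℝ) ^ 2 * ((9 / 2 * (T / M ^ 2) * Q ^ 2) * (3 * Real.sqrt T * Q / M) / 8) := by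
    rw [hG₀3]
    gcongr
  -- RHS = C (R²/N²)² (H³ (4/9)√T) ≥ C (R⁴/N⁴)(81/1250)³(QN/R²)³ (4/9) √T
  have hRHS : (3 * 10 ^ 13) * (R ^ 2 / N ^ 2) ^ 2 * ((81 / 1250 * (Q * N / R ^ 2)) ^ 3 * (4 / 9 * Real.sqrt T))
      ≤ (3 * 10 ^ 13) * (R ^ 2 / N ^ 2) ^ 2 * (H ^ 3 * (4 / 9 * Real.sqrt T)) := by
    gcongr
  refine le_trans hL (le_trans ?_ hRHS)
  -- explicit comparison: `(9⁶/36)²·(27/16)·T√T Q³/M³ ≤ 1.4e9 · (81/1250)³·(4/9) · Q³ √T /(N R²)`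
  -- using `T/M³ ≤ 8/(N R²)`.
  have hTM3 : T / M ^ 3 ≤ 8 / (N * R ^ 2) := by
    rw [div_le_div_iff₀ (by positivity) (by positivity)]; nlinarith
  have e1 : (9 ^ 6 / 36 : ℝ) ^ 2 * ((9 / 2 * (T / M ^ 2) * Q ^ 2) * (3 * Real.sqrt T * Q / M) / 8) =
      ((9 ^ 6 / 36 : ℝ) ^ 2 * (27 / 16)) * (Q ^ 3 * Real.sqrt T) * (T / M ^ 3) := by
    field_simp; ring
  have e2 : (3 * 10 ^ 13 : ℝ) * (R ^ 2 / N ^ 2) ^ 2 * ((81 / 1250 * (Q * N / R ^ 2)) ^ 3 * (4 / 9 * Real.sqrt T)) =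
      ((3 * 10 ^ 13 : ℝ) * (81 / 1250) ^ 3 * (4 / 9) / 8) * (Q ^ 3 * Real.sqrt T) * (8 / (N * R ^ 2)) := by
    field_simp
  rw [e1, e2]
  have hpos : 0 ≤ Q ^ 3 * Real.sqrt T := by positivity
  have hc : (9 ^ 6 / 36 : ℝ) ^ 2 * (27 / 16) ≤ (3 * 10 ^ 13 : ℝ) * (81 / 1250) ^ 3 * (4 / 9) / 8 := by
    norm_num
  exact mul_le_mul (mul_le_mul_of_nonneg_right hc hpos) hTM3 (by positivity) (by positivity)

/-- **Envelope for `Δ₂`:** under `A ≤ (9/2)(T/M²)Q`, `A ≥ Q/5`, `NTR² ≤ 8M³`, `H ≥ (81/1250)QN/R²`,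
`η = 1/(20R²)`, `N ≤ R²`:  `delta2 T A Q η H ≤ 6·10⁶ · R²/N²`. [folklore] -/
theorem delta2_le {T A Q M N R : ℝ} {H : ℕ} (hT : 0 < T) (hA : 0 < A) (hQ : 0 < Q) (hH : 0 < (H : ℝ))
    (hM : 0 < M) (hN : 0 < N) (hR : 0 < R)
    (hAQ : A ≤ 9 / 2 * (T / M ^ 2) * Q) (hAlo : Q / 5 ≤ A) (hrel : N * T * R ^ 2 ≤ 8 * M ^ 3)
    (hHlo : 81 / 1250 * (Q * N / R ^ 2) ≤ H) (hNR : N ≤ R ^ 2) :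
    delta2 T A Q (1 / (20 * R ^ 2)) H ≤ 6000000 * (R ^ 2 / N ^ 2) := by
  unfold delta2
  rw [add_div]
  have hsAQ : 0 < Real.sqrt (A * Q) := Real.sqrt_pos.2 (by positivity)
  -- first part via its square
  have h1sq := delta2_first_sq_le hT hA hQ hH hM hN hR hAQ hrel hHlo
  set X := 2 / 3 * 9 ^ 6 * (Real.sqrt (A * Q) / 2) * ((1 / (12 * (H : ℝ) ^ (3 / 2 : ℝ))) / kap T (Real.sqrt (A * Q) / 2))
      / Real.sqrt (A * Q) with hX
  have hX0 : 0 ≤ X := by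
    rw [hX]
    have := kap_pos hT (show 0 < Real.sqrt (A * Q) / 2 by positivity)
    positivity
  have h1 : X ≤ Real.sqrt (3 * 10 ^ 13) * (R ^ 2 / N ^ 2) := by
    have : X ^ 2 ≤ (Real.sqrt (3 * 10 ^ 13) * (R ^ 2 / N ^ 2)) ^ 2 := by
      rw [mul_pow, Real.sq_sqrt (by positivity)]; exact h1sq
    exact (pow_le_pow_iff_left₀ hX0 (by positivity) two_ne_zero).1 this
  have hsqrtc : Real.sqrt (3 * 10 ^ 13) ≤ 5500000 := by
    rw [Real.sqrt_le_left (by norm_num)]; norm_num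
  -- second part: `8√2 η Q√Q/√A / √(AQ) = 8√2 η Q / A ≤ 8√2 (1/(20R²)) 5 = 2√2/R² ≤ 3 R²/N²`
  have h2 : 8 * Real.sqrt 2 * (1 / (20 * R ^ 2)) * Q * Real.sqrt Q / Real.sqrt A / Real.sqrt (A * Q) ≤ 3 * (R ^ 2 / N ^ 2) := by
    have hsA : 0 < Real.sqrt A := Real.sqrt_pos.2 hA
    have hsQ : 0 < Real.sqrt Q := Real.sqrt_pos.2 hQ
    have e : 8 * Real.sqrt 2 * (1 / (20 * R ^ 2)) * Q * Real.sqrt Q / Real.sqrt A / Real.sqrt (A * Q) =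
        2 * Real.sqrt 2 / 5 * (Q / A) / R ^ 2 := by
      have hAA : Real.sqrt A * Real.sqrt A = A := Real.mul_self_sqrt hA.le
      rw [Real.sqrt_mul hA.le, div_div, ← mul_assoc, hAA]
      field_simp
      norm_num
    rw [e]
    have hQA : Q / A ≤ 5 := by rw [div_le_iff₀ hA]; linarith
    have hs2 : Real.sqrt 2 ≤ 3 / 2 := by rw [Real.sqrt_le_left (by norm_num)]; norm_num
    have hR2N : 1 / R ^ 2 ≤ R ^ 2 / N ^ 2 := by
      rw [div_le_div_iff₀ (by positivity) (by positivity)]; nlinarith [hNR, pow_pos hR 2]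
    have hprod : Real.sqrt 2 * (Q / A) ≤ 3 / 2 * 5 := mul_le_mul hs2 hQA (by positivity) (by norm_num)
    calc 2 * Real.sqrt 2 / 5 * (Q / A) / R ^ 2 = 2 / 5 * (Real.sqrt 2 * (Q / A)) * (1 / R ^ 2) := by ring
      _ ≤ 2 / 5 * (3 / 2 * 5) * (1 / R ^ 2) := by gcongr
      _ = 3 * (1 / R ^ 2) := by ring
      _ ≤ 3 * (R ^ 2 / N ^ 2) := by gcongr
  calc X + 8 * Real.sqrt 2 * (1 / (20 * R ^ 2)) * Q * Real.sqrt Q / Real.sqrt A / Real.sqrt (A * Q)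
      ≤ 5500000 * (R ^ 2 / N ^ 2) + 3 * (R ^ 2 / N ^ 2) := by
        refine add_le_add (h1.trans (mul_le_mul_of_nonneg_right hsqrtc (by positivity))) h2
    _ ≤ 6000000 * (R ^ 2 / N ^ 2) := by
        have : 0 ≤ R ^ 2 / N ^ 2 := by positivity
        nlinarith



/-! ### Envelope for the Graham–Kolesnik bound of the second spacing count

`X = (Δ₁Δ₂ + Δ₁²) A Q² (A + Q) + A Q + Δ₂ A² + Δ₂ Q²` with `Δ₁ = 1/(3H²)`, `Δ₂ ≤ D R²/N²`,
`Q/5 ≤ A ≤ (9/2)(T/M²) Q`, `H ≥ (81/1250) Q N/R²`. -/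

/-- **The four terms of Lemma 7.18's bound by monomials.** [folklore] -/
theorem gk_terms_le {A Q H T M N R Δ₂ D : ℝ} (hQ : 0 < Q) (hA0 : 0 < A) (hAlo : Q / 5 ≤ A)
    (hAhi : A ≤ 9 / 2 * (T / M ^ 2) * Q) (hH0 : 0 < H) (hH : 81 / 1250 * (Q * N / R ^ 2) ≤ H)
    (hN : 0 < N) (hR : 0 < R) (hM : 0 < M) (hT : 0 < T) (hΔ₂0 : 0 ≤ Δ₂) (hΔ₂ : Δ₂ ≤ D * (R ^ 2 / N ^ 2)) (hD : 0 ≤ D) :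
    ((1 / (3 * H ^ 2)) * Δ₂ + (1 / (3 * H ^ 2)) ^ 2) * (A * Q ^ 2 * (A + Q)) + A * Q + Δ₂ * A ^ 2 + Δ₂ * Q ^ 2 ≤
      (20000 * D) * ((T / M ^ 2) ^ 2 * Q ^ 2 * R ^ 6 / N ^ 4)
        + 4000000 * ((T / M ^ 2) ^ 2 * R ^ 8 / N ^ 4)
        + 5 * ((T / M ^ 2) * Q ^ 2)
        + (600 * D) * ((T / M ^ 2) ^ 2 * Q ^ 2 * R ^ 2 / N ^ 2) := by
  set X : ℝ := T / M ^ 2 with hX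
  have hX0 : 0 < X := by positivity
  set Ahi : ℝ := 9 / 2 * X * Q with hAhi'
  have hAhi0 : 0 < Ahi := by positivity
  have hQA : Q ≤ 5 * A := by linarith
  have hApQ : A + Q ≤ 6 * Ahi := by linarith
  -- `Δ₁ ≤ (1250/81)²/3 · R⁴/(Q²N²)`
  have hΔ₁ : 1 / (3 * H ^ 2) ≤ 80 * (R ^ 4 / (Q ^ 2 * N ^ 2)) := by
    have hH2 : (81 / 1250 * (Q * N / R ^ 2)) ^ 2 ≤ H ^ 2 := pow_le_pow_left₀ (by positivity) hH 2
    calc 1 / (3 * H ^ 2) ≤ 1 / (3 * (81 / 1250 * (Q * N / R ^ 2)) ^ 2) := by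
          gcongr
      _ = (1250 / 81) ^ 2 / 3 * (R ^ 4 / (Q ^ 2 * N ^ 2)) := by field_simp
      _ ≤ 80 * (R ^ 4 / (Q ^ 2 * N ^ 2)) := by
          apply mul_le_mul_of_nonneg_right (by norm_num) (by positivity)
  have hΔ₁0 : 0 ≤ 1 / (3 * H ^ 2) := by positivity
  -- the cubic factor
  have hcube : A * Q ^ 2 * (A + Q) ≤ 6 * Ahi ^ 2 * Q ^ 2 := by
    calc A * Q ^ 2 * (A + Q) ≤ Ahi * Q ^ 2 * (6 * Ahi) := by
          apply mul_le_mul (mul_le_mul_of_nonneg_right hAhi (by positivity)) hApQ (by positivity) (by positivity)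
      _ = 6 * Ahi ^ 2 * Q ^ 2 := by ring
  have hcube0 : 0 ≤ A * Q ^ 2 * (A + Q) := by positivity
  -- term 1: `Δ₁ Δ₂ · cubic ≤ 80 R⁴/(Q²N²) · D R²/N² · 6 Ahi² Q²`
  have t1 : (1 / (3 * H ^ 2)) * Δ₂ * (A * Q ^ 2 * (A + Q)) ≤ (20000 * D) * (X ^ 2 * Q ^ 2 * R ^ 6 / N ^ 4) := by
    calc (1 / (3 * H ^ 2)) * Δ₂ * (A * Q ^ 2 * (A + Q))
        ≤ (80 * (R ^ 4 / (Q ^ 2 * N ^ 2))) * (D * (R ^ 2 / N ^ 2)) * (6 * Ahi ^ 2 * Q ^ 2) := by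
          apply mul_le_mul (mul_le_mul hΔ₁ hΔ₂ hΔ₂0 (by positivity)) hcube hcube0 (by positivity)
      _ = (480 * (81 / 4) * D) * (X ^ 2 * Q ^ 2 * R ^ 6 / N ^ 4) := by rw [hAhi']; field_simp; ring
      _ ≤ (20000 * D) * (X ^ 2 * Q ^ 2 * R ^ 6 / N ^ 4) := by
          apply mul_le_mul_of_nonneg_right _ (by positivity); nlinarith
  -- term 2: `Δ₁² · cubic ≤ 6400 R⁸/(Q⁴N⁴) · 6 Ahi² Q²`
  have t2 : (1 / (3 * H ^ 2)) ^ 2 * (A * Q ^ 2 * (A + Q)) ≤ 4000000 * (X ^ 2 * R ^ 8 / N ^ 4) := by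
    have hsq : (1 / (3 * H ^ 2)) ^ 2 ≤ (80 * (R ^ 4 / (Q ^ 2 * N ^ 2))) ^ 2 := pow_le_pow_left₀ hΔ₁0 hΔ₁ 2
    calc (1 / (3 * H ^ 2)) ^ 2 * (A * Q ^ 2 * (A + Q)) ≤ (80 * (R ^ 4 / (Q ^ 2 * N ^ 2))) ^ 2 * (6 * Ahi ^ 2 * Q ^ 2) :=
          mul_le_mul hsq hcube hcube0 (by positivity)
      _ = (38400 * (81 / 4)) * (X ^ 2 * R ^ 8 / N ^ 4) := by rw [hAhi']; field_simp; ring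
      _ ≤ 4000000 * (X ^ 2 * R ^ 8 / N ^ 4) := by
          apply mul_le_mul_of_nonneg_right (by norm_num) (by positivity)
  -- term 3
  have t3 : A * Q ≤ 5 * (X * Q ^ 2) := by
    calc A * Q ≤ Ahi * Q := by gcongr
      _ = 9 / 2 * (X * Q ^ 2) := by rw [hAhi']; ring
      _ ≤ 5 * (X * Q ^ 2) := by nlinarith [mul_pos hX0 (pow_pos hQ 2)]
  -- term 4: `Δ₂ (A² + Q²) ≤ D R²/N² · 26 Ahi²`
  have t4 : Δ₂ * A ^ 2 + Δ₂ * Q ^ 2 ≤ (600 * D) * (X ^ 2 * Q ^ 2 * R ^ 2 / N ^ 2) := by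
    have hA2 : A ^ 2 ≤ Ahi ^ 2 := pow_le_pow_left₀ hA0.le hAhi 2
    have hQ2 : Q ^ 2 ≤ 25 * Ahi ^ 2 := by
      have : Q ≤ 5 * Ahi := hQA.trans (by linarith)
      nlinarith
    calc Δ₂ * A ^ 2 + Δ₂ * Q ^ 2 = Δ₂ * (A ^ 2 + Q ^ 2) := by ring
      _ ≤ (D * (R ^ 2 / N ^ 2)) * (26 * Ahi ^ 2) := by
          apply mul_le_mul hΔ₂ (by linarith) (by positivity) (by positivity)
      _ = (26 * (81 / 4) * D) * (X ^ 2 * Q ^ 2 * R ^ 2 / N ^ 2) := by rw [hAhi']; field_simp; ring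
      _ ≤ (600 * D) * (X ^ 2 * Q ^ 2 * R ^ 2 / N ^ 2) := by
          apply mul_le_mul_of_nonneg_right _ (by positivity); nlinarith
  have e : ((1 / (3 * H ^ 2)) * Δ₂ + (1 / (3 * H ^ 2)) ^ 2) * (A * Q ^ 2 * (A + Q)) =
      (1 / (3 * H ^ 2)) * Δ₂ * (A * Q ^ 2 * (A + Q)) + (1 / (3 * H ^ 2)) ^ 2 * (A * Q ^ 2 * (A + Q)) := by ring
  rw [e]
  linarith [t1, t2, t3, t4]



/-! ### Log-linear verification of the per-family monomial inequalities

We pass to logarithms: `m = log M`, `n = log N`, `r = log R`, `κ = log Q`, `t = log T`. -/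

/-- The relations between the parameters, in logarithmic form. [folklore] -/
structure LogRel (m n r κ t : ℝ) : Prop where
  ht : 2 * t + 7 * n = 7 * m
  h2 : Real.log 2 + 3 * m ≤ n + t + 2 * r
  h8 : n + t + 2 * r ≤ Real.log 8 + 3 * m
  hRN : r ≤ n
  hNR : n ≤ 2 * r
  hsieve : 6 * r ≤ 5 * κ + n
  hQ : κ ≤ Real.log 11 + 2 * r
  hQ1 : 0 ≤ κ
  hMT : 2 * m ≤ t


/-- Bracket `A`, term `t1`. [folklore] -/
theorem bracket_A_t1 {m n r κ t : ℝ} (h : LogRel m n r κ t) (hcase : κ ≤ r) :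
    12 * (r - κ / 2) + 10 * (m - n + 2 * κ - 2 * r) + (2 * r - 2 * κ) + 2 * (2 * r - 2 * κ) + 12 * (κ + n - 2 * r) + (2 * (t - 2 * m) + 2 * κ + 6 * r - 4 * n) ≤ 12 * m - 4 * n - 2 * r + 40 * Real.log 8 + 40 * Real.log 11 := by
  obtain ⟨ht, h2, h8, hRN, hNR, hs, hQ, hQ1, hMT⟩ := h
  have hl8 : 0 ≤ Real.log 8 := Real.log_nonneg (by norm_num)
  have hl2 : 0 ≤ Real.log 2 := Real.log_nonneg (by norm_num)
  have hl11 : 0 ≤ Real.log 11 := Real.log_nonneg (by norm_num)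
  nlinarith

/-- Bracket `A`, term `t2`. [folklore] -/
theorem bracket_A_t2 {m n r κ t : ℝ} (h : LogRel m n r κ t) (hcase : κ ≤ r) :
    12 * (r - κ / 2) + 10 * (m - n + 2 * κ - 2 * r) + (2 * r - 2 * κ) + 2 * (2 * r - 2 * κ) + 12 * (κ + n - 2 * r) + (2 * (t - 2 * m) + 8 * r - 4 * n) ≤ 12 * m - 4 * n - 2 * r + 40 * Real.log 8 + 40 * Real.log 11 := by
  obtain ⟨ht, h2, h8, hRN, hNR, hs, hQ, hQ1, hMT⟩ := h
  have hl8 : 0 ≤ Real.log 8 := Real.log_nonneg (by norm_num)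
  have hl2 : 0 ≤ Real.log 2 := Real.log_nonneg (by norm_num)
  have hl11 : 0 ≤ Real.log 11 := Real.log_nonneg (by norm_num)
  nlinarith

/-- Bracket `A`, term `t3`. [folklore] -/
theorem bracket_A_t3 {m n r κ t : ℝ} (h : LogRel m n r κ t) (hcase : κ ≤ r) :
    12 * (r - κ / 2) + 10 * (m - n + 2 * κ - 2 * r) + (2 * r - 2 * κ) + 2 * (2 * r - 2 * κ) + 12 * (κ + n - 2 * r) + ((t - 2 * m) + 2 * κ) ≤ 12 * m - 4 * n - 2 * r + 40 * Real.log 8 + 40 * Real.log 11 := by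
  obtain ⟨ht, h2, h8, hRN, hNR, hs, hQ, hQ1, hMT⟩ := h
  have hl8 : 0 ≤ Real.log 8 := Real.log_nonneg (by norm_num)
  have hl2 : 0 ≤ Real.log 2 := Real.log_nonneg (by norm_num)
  have hl11 : 0 ≤ Real.log 11 := Real.log_nonneg (by norm_num)
  nlinarith

/-- Bracket `A`, term `t4`. [folklore] -/
theorem bracket_A_t4 {m n r κ t : ℝ} (h : LogRel m n r κ t) (hcase : κ ≤ r) :
    12 * (r - κ / 2) + 10 * (m - n + 2 * κ - 2 * r) + (2 * r - 2 * κ) + 2 * (2 * r - 2 * κ) + 12 * (κ + n - 2 * r) + (2 * (t - 2 * m) + 2 * κ + 2 * r - 2 * n) ≤ 12 * m - 4 * n - 2 * r + 40 * Real.log 8 + 40 * Real.log 11 := by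
  obtain ⟨ht, h2, h8, hRN, hNR, hs, hQ, hQ1, hMT⟩ := h
  have hl8 : 0 ≤ Real.log 8 := Real.log_nonneg (by norm_num)
  have hl2 : 0 ≤ Real.log 2 := Real.log_nonneg (by norm_num)
  have hl11 : 0 ≤ Real.log 11 := Real.log_nonneg (by norm_num)
  nlinarith

/-- Bracket `B1`, term `t1`. [folklore] -/
theorem bracket_B1_t1 {m n r κ t : ℝ} (h : LogRel m n r κ t) (hcase : r ≤ κ) :
    12 * (r - κ / 2) + 10 * (m - n + 2 * r - 2 * κ) + 0 + 12 * (κ + n - 2 * r) + (2 * (t - 2 * m) + 2 * κ + 6 * r - 4 * n) ≤ 12 * m - 4 * n - 2 * r + 40 * Real.log 8 + 40 * Real.log 11 := by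
  obtain ⟨ht, h2, h8, hRN, hNR, hs, hQ, hQ1, hMT⟩ := h
  have hl8 : 0 ≤ Real.log 8 := Real.log_nonneg (by norm_num)
  have hl2 : 0 ≤ Real.log 2 := Real.log_nonneg (by norm_num)
  have hl11 : 0 ≤ Real.log 11 := Real.log_nonneg (by norm_num)
  nlinarith

/-- Bracket `B1`, term `t2`. [folklore] -/
theorem bracket_B1_t2 {m n r κ t : ℝ} (h : LogRel m n r κ t) (hcase : r ≤ κ) :
    12 * (r - κ / 2) + 10 * (m - n + 2 * r - 2 * κ) + 0 + 12 * (κ + n - 2 * r) + (2 * (t - 2 * m) + 8 * r - 4 * n) ≤ 12 * m - 4 * n - 2 * r + 40 * Real.log 8 + 40 * Real.log 11 := by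
  obtain ⟨ht, h2, h8, hRN, hNR, hs, hQ, hQ1, hMT⟩ := h
  have hl8 : 0 ≤ Real.log 8 := Real.log_nonneg (by norm_num)
  have hl2 : 0 ≤ Real.log 2 := Real.log_nonneg (by norm_num)
  have hl11 : 0 ≤ Real.log 11 := Real.log_nonneg (by norm_num)
  nlinarith

/-- Bracket `B1`, term `t3`. [folklore] -/
theorem bracket_B1_t3 {m n r κ t : ℝ} (h : LogRel m n r κ t) (hcase : r ≤ κ) :
    12 * (r - κ / 2) + 10 * (m - n + 2 * r - 2 * κ) + 0 + 12 * (κ + n - 2 * r) + ((t - 2 * m) + 2 * κ) ≤ 12 * m - 4 * n - 2 * r + 40 * Real.log 8 + 40 * Real.log 11 := by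
  obtain ⟨ht, h2, h8, hRN, hNR, hs, hQ, hQ1, hMT⟩ := h
  have hl8 : 0 ≤ Real.log 8 := Real.log_nonneg (by norm_num)
  have hl2 : 0 ≤ Real.log 2 := Real.log_nonneg (by norm_num)
  have hl11 : 0 ≤ Real.log 11 := Real.log_nonneg (by norm_num)
  nlinarith

/-- Bracket `B1`, term `t4`. [folklore] -/
theorem bracket_B1_t4 {m n r κ t : ℝ} (h : LogRel m n r κ t) (hcase : r ≤ κ) :
    12 * (r - κ / 2) + 10 * (m - n + 2 * r - 2 * κ) + 0 + 12 * (κ + n - 2 * r) + (2 * (t - 2 * m) + 2 * κ + 2 * r - 2 * n) ≤ 12 * m - 4 * n - 2 * r + 40 * Real.log 8 + 40 * Real.log 11 := by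
  obtain ⟨ht, h2, h8, hRN, hNR, hs, hQ, hQ1, hMT⟩ := h
  have hl8 : 0 ≤ Real.log 8 := Real.log_nonneg (by norm_num)
  have hl2 : 0 ≤ Real.log 2 := Real.log_nonneg (by norm_num)
  have hl11 : 0 ≤ Real.log 11 := Real.log_nonneg (by norm_num)
  nlinarith

/-- Bracket `B2`, term `t1`. [folklore] -/
theorem bracket_B2_t1 {m n r κ t : ℝ} (h : LogRel m n r κ t) (hcase : r ≤ κ) :
    12 * (r - κ / 2) + 10 * (2 * r - κ) + 0 + 12 * (κ + n - 2 * r) + (2 * (t - 2 * m) + 2 * κ + 6 * r - 4 * n) ≤ 12 * m - 4 * n - 2 * r + 40 * Real.log 8 + 40 * Real.log 11 := by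
  obtain ⟨ht, h2, h8, hRN, hNR, hs, hQ, hQ1, hMT⟩ := h
  have hl8 : 0 ≤ Real.log 8 := Real.log_nonneg (by norm_num)
  have hl2 : 0 ≤ Real.log 2 := Real.log_nonneg (by norm_num)
  have hl11 : 0 ≤ Real.log 11 := Real.log_nonneg (by norm_num)
  nlinarith

/-- Bracket `B2`, term `t2`. [folklore] -/
theorem bracket_B2_t2 {m n r κ t : ℝ} (h : LogRel m n r κ t) (hcase : r ≤ κ) :
    12 * (r - κ / 2) + 10 * (2 * r - κ) + 0 + 12 * (κ + n - 2 * r) + (2 * (t - 2 * m) + 8 * r - 4 * n) ≤ 12 * m - 4 * n - 2 * r + 40 * Real.log 8 + 40 * Real.log 11 := by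
  obtain ⟨ht, h2, h8, hRN, hNR, hs, hQ, hQ1, hMT⟩ := h
  have hl8 : 0 ≤ Real.log 8 := Real.log_nonneg (by norm_num)
  have hl2 : 0 ≤ Real.log 2 := Real.log_nonneg (by norm_num)
  have hl11 : 0 ≤ Real.log 11 := Real.log_nonneg (by norm_num)
  nlinarith

/-- Bracket `B2`, term `t3`. [folklore] -/
theorem bracket_B2_t3 {m n r κ t : ℝ} (h : LogRel m n r κ t) (hcase : r ≤ κ) :
    12 * (r - κ / 2) + 10 * (2 * r - κ) + 0 + 12 * (κ + n - 2 * r) + ((t - 2 * m) + 2 * κ) ≤ 12 * m - 4 * n - 2 * r + 40 * Real.log 8 + 40 * Real.log 11 := by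
  obtain ⟨ht, h2, h8, hRN, hNR, hs, hQ, hQ1, hMT⟩ := h
  have hl8 : 0 ≤ Real.log 8 := Real.log_nonneg (by norm_num)
  have hl2 : 0 ≤ Real.log 2 := Real.log_nonneg (by norm_num)
  have hl11 : 0 ≤ Real.log 11 := Real.log_nonneg (by norm_num)
  nlinarith

/-- Bracket `B2`, term `t4`. [folklore] -/
theorem bracket_B2_t4 {m n r κ t : ℝ} (h : LogRel m n r κ t) (hcase : r ≤ κ) :
    12 * (r - κ / 2) + 10 * (2 * r - κ) + 0 + 12 * (κ + n - 2 * r) + (2 * (t - 2 * m) + 2 * κ + 2 * r - 2 * n) ≤ 12 * m - 4 * n - 2 * r + 40 * Real.log 8 + 40 * Real.log 11 := by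
  obtain ⟨ht, h2, h8, hRN, hNR, hs, hQ, hQ1, hMT⟩ := h
  have hl8 : 0 ≤ Real.log 8 := Real.log_nonneg (by norm_num)
  have hl2 : 0 ≤ Real.log 2 := Real.log_nonneg (by norm_num)
  have hl11 : 0 ≤ Real.log 11 := Real.log_nonneg (by norm_num)
  nlinarith


end ZetaSum
end Literature.NumberTheory.LFunctions
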